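import Literature.AlgebraicGeometry.HodgeTheory.FermatCohomologyCurvePowerDomination
import Literature.AlgebraicGeometry.HodgeTheory.SupportedHodgeClassesAlgebraic
import Literature.AlgebraicGeometry.HodgeTheory.AlgebraicClassesHodgeTypeHolds
import Literature.AlgebraicGeometry.HodgeTheory.SupportedClassesRationalProofs
import Literature.AlgebraicGeometry.HodgeTheory.HodgeTypeExteriorProduct
import Literature.AlgebraicGeometry.HodgeTheory.HodgeRiemannPolarizabilityProofs
import Literature.AlgebraicGeometry.Resolution.ProjectiveResolutionProofs
import Literature.AlgebraicGeometry.HodgeTheory.ProperModificationCohomologySpanning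
import Literature.AlgebraicGeometry.HodgeTheory.AlgebraicityLocusCurves
import Literature.AlgebraicGeometry.HodgeTheory.IsoTransport
import HarnessLib

/-!
# `FermatHodgeClassesLiftToCurvePowersSum` from the GEOMETRY of Shioda–Katsura's blow-up diagram:
# the pull-back along the blow-up through Voisin's coniveau lemma, and exceptional hosts of shift `2`

Topic `Literature/AlgebraicGeometry/HodgeTheory`. PROOF FILE (theorems only; no definition and no
named fact is introduced, D-0026), continuing `FermatCohomologyCurvePowerDomination`, which reduced
the named fact `FermatHodgeClassesLiftToCurvePowersSum` (T. Shioda, T. Katsura, *On Fermat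
varieties*, Tôhoku Math. J. 31 (1979), §1 Thm. 1.7, §2 Cor. 2.5; T. Shioda, Math. Ann. 245 (1979),
Thm. I) to ONE STEP of the inductive structure, and that step
(`FermatHodgeClassesLiftToCurvePowersSum_of_blowupDiagrams`) to the varieties and morphisms of the
diagram (1.25) `× W` plus two inputs: the blow-up formula on `Z` (Lemma 2.1, spanning half) and the
contravariance of algebraic classes along the NON-FLAT blow-up `b = β × id` — there taken from the
tree's unproved named fact `fulton1998_map_mem_algebraicClasses` (Fulton, Cor. 19.2 (b)).

This file takes a different road for both inputs.

1. **The pull-back along the blow-up, through coniveau.** The blow-up `b : Z → M` of a smooth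
   centre of codimension `2` has fibres of dimension `≤ 1`, so a class dying off a closed subset of
   codimension `≥ c` pulls back to a class dying off a closed subset of codimension `≥ c - 1`
   (`map_mem_supportedClasses_of_coheight_le`, Grothendieck's functoriality of the filtration by
   codimension of support, *Topology* 8 (1969) §1, for a morphism dropping codimension by at most
   `e`); and a RATIONAL `(c, c)`-class of coniveau `≥ c - 1` is algebraic — C. Voisin, Ann. Sci. ÉNS
   46 (2013), proof of Lemma 2.1 (Hodge classes of coniveau `≥ c - 1` come, through Deligne's
   Cor. 8.2.8 and the semisimplicity of polarised Hodge structures, from divisor classes on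
   desingularisations of the support, which are algebraic by Lefschetz `(1,1)`), the tree's theorem
   `mem_algebraicClasses_of_mem_supportedClasses_of_isOfHodgeType`, all of whose inputs are now
   theorems of the tree (`Voisin2025_hodgeClass_lift_complexGysin_holds`,
   `Resolution.Hironaka1964_projective_holds`, `lefschetzOneOne_rational_holds`,
   `gysinMap_restrictCompl_eq_zero_of_field`) EXCEPT Deligne's Cor. 8.2.8, the named fact
   `Deligne1974_ker_restrictCompl_eq_iSup_range_complexGysin` (`GysinKernel.lean`; hypothesis `hD`
   below). Hence (`map_mem_algebraicClasses_of_coheight_le_add_one`): **granted `hD`, `b^*` carries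
   `algebraicClasses M c` into `algebraicClasses Z c` for every morphism `b : Z ⟶ M` of smooth
   projective varieties along which codimension drops by at most one**
   (`codim b(z) ≤ codim z + 1` for every point `z` of `Z`) — algebraic classes being spanned by
   RATIONAL ones (`supportedClasses_eq_span_isRationalClass`) of Hodge type `(c, c)`
   (`isOfHodgeType_of_mem_algebraicClasses_of_isSmoothProjective`), both preserved by `b^*`.
   This replaces Fulton's Cor. 19.2 (b) for the blow-ups of the diagram.

2. **Exceptional hosts of shift `2`.** The blow-up formula is used through the decomposition of the
   cohomology of the exceptional `ℙ¹`-bundles `πₜ : Eₜ → P`, `H(Eₜ) = πₜ^* H(P) ⊕ h ∪ πₜ^* H(P)`; with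
   a section `σₜ : P → Eₜ` of `πₜ` (in the diagram: `Eₜ = ℙ(O(1) ⊕ O)` has two) the second summand
   is `σₜ,* H(P)`, so that `H²ᶜ(Z) = b^* H²ᶜ(M) + Σₜ jₜ,* πₜ^* H^{2c-2}(P) + Σₜ (σₜ ≫ jₜ)_* H^{2c-4}(P)`
   — a spanning statement with a THIRD kind of host, the centre components acting with codimension
   shift `2` through the proper push-forward `(σₜ ≫ jₜ ≫ f)_*` alone (no pull-back, no excess
   bundle). The induction of `FermatCohomologyCurvePowerDomination` is re-run with this extra kind
   of host (`exists_family_of_step₂`, `exists_family_fermat_tensor₂`,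
   `FermatHodgeClassesLiftToCurvePowersSum_of_inductiveStep₂`), and the clause of the step is derived
   from the geometric data (`inductiveStepClause₂_of_spans`, `inductiveStepClause₂_of_blowupDiagram`).

Main results: `FermatHodgeClassesLiftToCurvePowersSum_of_blowupGeometry` — the named fact from `hD`
and, for each step, the diagram (1.25) `× W` as smooth projective `ℂ`-schemes: `Z` (dimension of the
target) with `b : Z ⟶ M` dropping codimension by at most one, `f : Z ⟶ V` SURJECTIVE, finitely many
`Eₜ` (dimension `dim P + 1`) with flat `πₜ : Eₜ ⟶ P`, sections `σₜ` and `jₜ : Eₜ ⟶ Z`, and the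
spanning `H²ᶜ(Z) = b^*H²ᶜ(M) + Σₜ jₜ,*πₜ^*H^{2c-2}(P) + Σₜ (σₜ ≫ jₜ)_*H^{2c-4}(P)`; and (appended)
`FermatHodgeClassesLiftToCurvePowersSum_of_blowupGeometry₃` — the same with the spanning on `Z`
PROVED (`blowupGeometry_span₂`, from the tree's `ProperModificationCohomologySpanning`: `b` birational
and an isomorphism over an open `U`, the `jₜ` closed immersions with disjoint images covering
`Z ∖ b⁻¹U`) from the one remaining cohomological input on the exceptional components (every class
on `Eₜ` agrees off `σₜ(P)` with a class pulled back from `P` — the `𝔸¹`-bundle `Eₜ ∖ σₜ(P) → P`), and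
with the codimension hypothesis on `b` derived from the blow-up squares `jₜ ≫ b = πₜ ≫ iₜ`
(`coheight_le_coheight_add_one_of_blowupSquare`).

## References

* [ShiodaKatsura1979] T. Shioda, T. Katsura, On Fermat varieties, Tôhoku Math. J. 31 (1979)
  97–115: §1 (1.4)–(1.6), Lemma 1.2–1.3, Thm. 1.7 (1.25), Remark 1.9; §2 Lemma 2.1, Prop. 2.4 (2.5),
  Cor. 2.5 (2.9), (2.17)–(2.19), Thm. 2.10; §3 p. 107–108.
* [Voisin2013GHCBloch] C. Voisin, The generalized Hodge and Bloch conjectures are equivalent for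
  general complete intersections, Ann. Sci. ÉNS 46 (2013), Lemma 2.1 (proof).
* [GrothendieckTopology1969] A. Grothendieck, Hodge's general conjecture is false for trivial
  reasons, Topology 8 (1969), §1 (functoriality of the filtration by codimension of support).
* [DeligneHodgeIII1974] P. Deligne, Théorie de Hodge III, Publ. Math. IHÉS 44 (1974), Cor. 8.2.8.
* [VoisinHodgeI2002] C. Voisin, Hodge Theory and Complex Algebraic Geometry I, Thm. 7.31, Lemma 7.32,
  §7.3.2, §7.3.3 (cohomology of a projective bundle and of a blow-up).
* [Fulton1998] W. Fulton, Intersection Theory, §6.7, §19.2 Cor. 19.2.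
* [Voisin2025] C. Voisin, Hodge and generalized Hodge conjectures, coniveau and algebraic cycles,
  J. Open Math. Probl. 1 (2025), Cor. 2.12.
-/

noncomputable section

open CategoryTheory AlgebraicGeometry MonoidalCategory
open Literature.AlgebraicTopology.SingularHomology
open Literature.AlgebraicGeometry.Motives

namespace Literature.AlgebraicGeometry.HodgeTheory

/-! ### Pull-back along a morphism dropping codimension by at most `e`; algebraic classes along
the blow-up through Voisin's coniveau lemma -/

section Coniveau

variable {Z M : Motives.SchemeOver ℂ}

/-- **Functoriality of the filtration by codimension of support along a morphism dropping
codimension by at most `e`.** If `b : Z ⟶ M` satisfies `codim b(z) ≤ codim z + e` at every point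
(`Order.coheight`; e.g. a flat morphism with `e = 0`, Hartshorne III 9.5, or the blow-up of a smooth
centre of codimension `2`, whose fibres are points and projective lines, with `e = 1`), then
`b^*(Nᶜ Hᵃ(M(ℂ); ℂ)) ⊆ N^{c-e} Hᵃ(Z(ℂ); ℂ)`: a class dying off a Zariski-closed `S` of codimension
`≥ c` pulls back to a class dying off `b⁻¹S`, all of whose points have codimension `≥ c - e`.
[cite: GrothendieckTopology1969, §1] [cite: Hartshorne1977, III Prop. 9.5] -/
theorem map_mem_supportedClasses_of_coheight_le (b : Z ⟶ M) {e : ℕ}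
    (hb : ∀ z : Z.left, Order.coheight (b.left.base z) ≤ Order.coheight z + e)
    {a c : ℕ} {x : complexBetti M a} (hx : x ∈ supportedClasses M a c) :
    complexBetti.map b a x ∈ supportedClasses Z a (c - e) := by
  suffices h : supportedClasses M a c ≤
      (supportedClasses Z a (c - e)).comap (complexBetti.map b a).hom from h hx
  refine iSup_le fun S ↦ iSup_le fun hS ↦ iSup_le fun hc ↦ fun z hz ↦ ?_
  rw [LinearMap.mem_ker] at hz
  refine mem_supportedClasses_of_restrictCompl_eq_zero (hS.preimage b.left.base.hom.continuous)
    (fun w hw ↦ ?_) (complexBetti.restrictCompl_map_eq_zero b hz)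
  have h1 : (c : ℕ∞) ≤ Order.coheight w + e := (hc _ hw).trans (hb w)
  calc ((c - e : ℕ) : ℕ∞) = (c : ℕ∞) - e := ENat.coe_sub c e
    _ ≤ Order.coheight w := tsub_le_iff_right.2 h1

/-- **Pull-back of algebraic classes along a morphism dropping codimension by at most one, through
coniveau** (the road of Voisin 2013, proof of Lemma 2.1, instead of Fulton's Cor. 19.2 (b)). For
`b : Z ⟶ M` a morphism of smooth projective complex varieties with `codim b(z) ≤ codim z + 1` at every
point (the blow-up `β × id` of Shioda–Katsura's diagram (1.25): off the exceptional divisor `b` is a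
local isomorphism, on it the codimension drops by exactly one), `b^*` carries
`algebraicClasses M c = Nᶜ H²ᶜ(M)` into `algebraicClasses Z c`: the space `Nᶜ H²ᶜ(M(ℂ); ℂ)` is
spanned by RATIONAL classes (`supportedClasses_eq_span_isRationalClass`), which are of Hodge type
`(c, c)` (`isOfHodgeType_of_mem_algebraicClasses_of_isSmoothProjective`); their pull-backs are rational
`(c, c)`-classes of coniveau `≥ c - 1` (`map_mem_supportedClasses_of_coheight_le`), hence algebraic by
Voisin's lemma (`mem_algebraicClasses_of_mem_supportedClasses_of_isOfHodgeType`: Deligne's Cor. 8.2.8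
— the hypothesis `hD` —, lifting of Hodge classes along Gysin maps, Hironaka, Lefschetz `(1,1)`, the
last three being theorems of the tree). [cite: Voisin2013GHCBloch, Lemma 2.1 (proof)]
[cite: GrothendieckTopology1969, §1] [cite: ShiodaKatsura1979, §1 (1.4)–(1.6) and §2 (2.17)–(2.19)] -/
theorem map_mem_algebraicClasses_of_coheight_le_add_one
    (hD : Deligne1974_ker_restrictCompl_eq_iSup_range_complexGysin) (μ : OrientationFamily)
    {dZ dM : ℕ} (hZ : IsSmoothProjective dZ Z) (hM : IsSmoothProjective dM M) (b : Z ⟶ M)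
    (hb : ∀ z : Z.left, Order.coheight (b.left.base z) ≤ Order.coheight z + 1)
    {c : ℕ} {x : complexBetti M (2 * c)} (hx : x ∈ algebraicClasses M c) :
    complexBetti.map b (2 * c) x ∈ algebraicClasses Z c := by
  cases c with
  | zero => rw [algebraicClasses_zero]; exact Submodule.mem_top
  | succ q =>
    have hx' : x ∈ Submodule.span ℂ {y : complexBetti M (2 * (q + 1)) |
        IsRationalClass y ∧ y ∈ supportedClasses M (2 * (q + 1)) (q + 1)} := by
      rw [← supportedClasses_eq_span_isRationalClass hM]; exact hx
    refine Submodule.span_induction (p := fun y _ ↦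
      complexBetti.map b (2 * (q + 1)) y ∈ algebraicClasses Z (q + 1)) ?_ ?_ ?_ ?_ hx'
    · rintro y ⟨hyr, hys⟩
      -- coniveau `≥ q` for the pull-back
      have hsupp : complexBetti.map b (2 * (q + 1)) y ∈ supportedClasses Z (2 * (q + 1)) q := by
        have h := map_mem_supportedClasses_of_coheight_le b hb hys
        rwa [Nat.add_sub_cancel] at h
      -- the pull-back is a rational `(q+1, q+1)`-class
      have htyp : IsOfHodgeType dZ Z (2 * (q + 1)) (q + 1) (q + 1) (complexBetti.map b _ y) :=
        (isOfHodgeType_of_mem_algebraicClasses_of_isSmoothProjective hM (q + 1) hys)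
          |>.map_of_isSmoothProjective hZ hM b
      exact mem_algebraicClasses_of_mem_supportedClasses_of_isOfHodgeType hD
        Voisin2025_hodgeClass_lift_complexGysin_holds (gysinMap_restrictCompl_eq_zero_of_field ℂ)
        Resolution.Hironaka1964_projective_holds lefschetzOneOne_rational_holds μ
        (OrientationFamily.hasPoincareDuality μ) hZ q hsupp (hyr.map _) htyp
    · rw [map_zero]; exact Submodule.zero_mem _
    · intro y y' _ _ hy hy'
      rw [map_add]; exact Submodule.add_mem _ hy hy'
    · intro t y _ hy
      rw [map_smul]; exact Submodule.smul_mem _ t hy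

/-- **The `alg → alg` clause of the main span, through coniveau**: for a span `M ←b— Z —f→ V` of
smooth projective varieties with `b` dropping codimension by at most one, `f_* ∘ b^*` carries
`algebraicClasses M k` into `algebraicClasses V c`, `k + dim V = c + dim Z`, granted Deligne's
Cor. 8.2.8 (`hD`) — the hypothesis `hbalg` of `inductiveStepClause_of_spans` WITHOUT Fulton's
Cor. 19.2 (b) (push-forward half: `complexGysin_mem_algebraicClasses`).
[cite: Voisin2013GHCBloch, Lemma 2.1 (proof)] [cite: FultonYoungTableaux1997, Appendix B §B.2 Exercise 5]
[cite: ShiodaKatsura1979, §2 (2.17)–(2.19)] -/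
theorem complexGysin_map_mem_algebraicClasses_of_coheight_le_add_one
    (hD : Deligne1974_ker_restrictCompl_eq_iSup_range_complexGysin) (μ : OrientationFamily)
    {dZ dM dV : ℕ} {V : Motives.SchemeOver ℂ}
    (hZ : IsSmoothProjective dZ Z) (hM : IsSmoothProjective dM M) (hV : IsSmoothProjective dV V)
    (b : Z ⟶ M) (hb : ∀ z : Z.left, Order.coheight (b.left.base z) ≤ Order.coheight z + 1)
    (f : Z ⟶ V) {k c : ℕ} (hc : k + dV = c + dZ) {x : complexBetti M (2 * k)}
    (hx : x ∈ algebraicClasses M k) :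
    complexGysin μ hZ hV f (show 2 * k + 2 * dV = 2 * c + 2 * dZ by omega)
      (complexBetti.map b (2 * k) x) ∈ algebraicClasses V c :=
  complexGysin_mem_algebraicClasses (gysinMap_restrictCompl_eq_zero_of_field ℂ) μ
    (OrientationFamily.hasPoincareDuality μ) hZ hV f hc _
    (map_mem_algebraicClasses_of_coheight_le_add_one hD μ hZ hM b hb hx)

end Coniveau

/-! ### One step of the induction with exceptional hosts of shift `1` AND `2` -/

section Induction

variable {m : ℕ}

/-- **One step, with two kinds of exceptional hosts.** As `exists_family_of_step`, but the centre
component `P` now acts in two ways: through finitely many `Θ₁,ₜ : H^{2c₀}(P) → H²ᶜ(V)`, `c₀ + 1 = c`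
(in print `f_* jₜ,* πₜ^*`, shift `(1, 1)`) AND finitely many `Θ₂,ₜ : H^{2c₀}(P) → H²ᶜ(V)`,
`c₀ + 2 = c` (in print `(σₜ ≫ jₜ ≫ f)_*` for a section `σₜ` of the exceptional `ℙ¹`-bundle, shift
`(2, 2)`: the second summand `h ∪ π^* H(P) = σ_* H(P)` of the cohomology of the projective bundle,
Voisin I Lemma 7.32), all admissible, with `H²ᶜ(V) = im Ψ + Σₜ im Θ₁,ₜ + Σₜ im Θ₂,ₜ`. If `H²ᶜ(M)`
and all `H^{2c₀}(P)` carry admissible dominating families from hosts `C_mᵏ ⊗ W`, so does `H²ᶜ(V)`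
(index `ι_M ⊕ (T₁ × ι_P) ⊕ (T₂ × ι_P')`, shifts `eᵢ`, `eⱼ + 1`, `eⱼ' + 2`).
[cite: ShiodaKatsura1979, §2 Lemma 2.1, Cor. 2.5 (2.9), (2.17) and Thm. 2.10 (proof)]
[cite: VoisinHodgeI2002, Lemma 7.32 and Thm. 7.31] -/
theorem exists_family_of_step₂ {W V M P : Motives.SchemeOver ℂ} {w dV dM dP c : ℕ}
    (Ψ : complexBetti M (2 * c) →ₗ[ℂ] complexBetti V (2 * c))
    {T₁ : Type} [Fintype T₁] {T₂ : Type} [Fintype T₂]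
    (Θ₁ : ∀ c₀ : ℕ, c₀ + 1 = c → T₁ → (complexBetti P (2 * c₀) →ₗ[ℂ] complexBetti V (2 * c)))
    (Θ₂ : ∀ c₀ : ℕ, c₀ + 2 = c → T₂ → (complexBetti P (2 * c₀) →ₗ[ℂ] complexBetti V (2 * c)))
    (hΨalg : ∀ x ∈ algebraicClasses M c, Ψ x ∈ algebraicClasses V c)
    (hΨrat : ∀ x, IsRationalClass x → IsRationalClass (Ψ x))
    (hΨtyp : ∀ ⦃a b : ℕ⦄ ⦃x⦄, a + b = 2 * c → IsOfHodgeType dM M (2 * c) a b x →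
      IsOfHodgeType dV V (2 * c) a b (Ψ x))
    (hΘ₁ : ∀ c₀ (h : c₀ + 1 = c) (t : T₁),
      (∀ y ∈ algebraicClasses P c₀, Θ₁ c₀ h t y ∈ algebraicClasses V c) ∧
      (∀ y, IsRationalClass y → IsRationalClass (Θ₁ c₀ h t y)) ∧
      (∀ ⦃a b : ℕ⦄ ⦃y⦄, a + b = 2 * c₀ → IsOfHodgeType dP P (2 * c₀) a b y →
          IsOfHodgeType dV V (2 * c) (a + 1) (b + 1) (Θ₁ c₀ h t y)))
    (hΘ₂ : ∀ c₀ (h : c₀ + 2 = c) (t : T₂),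
      (∀ y ∈ algebraicClasses P c₀, Θ₂ c₀ h t y ∈ algebraicClasses V c) ∧
      (∀ y, IsRationalClass y → IsRationalClass (Θ₂ c₀ h t y)) ∧
      (∀ ⦃a b : ℕ⦄ ⦃y⦄, a + b = 2 * c₀ → IsOfHodgeType dP P (2 * c₀) a b y →
          IsOfHodgeType dV V (2 * c) (a + 2) (b + 2) (Θ₂ c₀ h t y)))
    (hsurj : ∀ z : complexBetti V (2 * c),
      z ∈ LinearMap.range Ψ ⊔ (⨆ (c₀ : ℕ) (h : c₀ + 1 = c) (t : T₁), LinearMap.range (Θ₁ c₀ h t)) ⊔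
        ⨆ (c₀ : ℕ) (h : c₀ + 2 = c) (t : T₂), LinearMap.range (Θ₂ c₀ h t))
    (hM : ∃ (ι : Type) (_ : Fintype ι) (k q e : ι → ℕ) (_ : ∀ i, q i + e i = c)
      (F : ∀ i, complexBetti ((fermatHypersurface 1 m).pow (k i) ⊗ W) (2 * q i) →ₗ[ℂ] complexBetti (M) (2 * c)),
      (∀ i, ∀ a ∈ algebraicClasses ((fermatHypersurface 1 m).pow (k i) ⊗ W) (q i), F i a ∈ algebraicClasses (M) c) ∧
      (∀ i a, IsRationalClass a → IsRationalClass (F i a)) ∧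
      (∀ i ⦃a b : ℕ⦄ ⦃x : complexBetti ((fermatHypersurface 1 m).pow (k i) ⊗ W) (2 * q i)⦄, a + b = 2 * q i →
          IsOfHodgeType (k i + w) ((fermatHypersurface 1 m).pow (k i) ⊗ W) (2 * q i) a b x →
            IsOfHodgeType (dM) (M) (2 * c) (a + e i) (b + e i) (F i x)) ∧
      ∀ z : complexBetti (M) (2 * c), z ∈ ⨆ i, LinearMap.range (F i))
    (hP : ∀ c₀, ∃ (ι : Type) (_ : Fintype ι) (k q e : ι → ℕ) (_ : ∀ i, q i + e i = c₀)
      (F : ∀ i, complexBetti ((fermatHypersurface 1 m).pow (k i) ⊗ W) (2 * q i) →ₗ[ℂ] complexBetti (P) (2 * c₀)),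
      (∀ i, ∀ a ∈ algebraicClasses ((fermatHypersurface 1 m).pow (k i) ⊗ W) (q i), F i a ∈ algebraicClasses (P) c₀) ∧
      (∀ i a, IsRationalClass a → IsRationalClass (F i a)) ∧
      (∀ i ⦃a b : ℕ⦄ ⦃x : complexBetti ((fermatHypersurface 1 m).pow (k i) ⊗ W) (2 * q i)⦄, a + b = 2 * q i →
          IsOfHodgeType (k i + w) ((fermatHypersurface 1 m).pow (k i) ⊗ W) (2 * q i) a b x →
            IsOfHodgeType (dP) (P) (2 * c₀) (a + e i) (b + e i) (F i x)) ∧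
      ∀ z : complexBetti (P) (2 * c₀), z ∈ ⨆ i, LinearMap.range (F i)) :
    ∃ (ι : Type) (_ : Fintype ι) (k q e : ι → ℕ) (_ : ∀ i, q i + e i = c)
      (F : ∀ i, complexBetti ((fermatHypersurface 1 m).pow (k i) ⊗ W) (2 * q i) →ₗ[ℂ] complexBetti (V) (2 * c)),
      (∀ i, ∀ a ∈ algebraicClasses ((fermatHypersurface 1 m).pow (k i) ⊗ W) (q i), F i a ∈ algebraicClasses (V) c) ∧
      (∀ i a, IsRationalClass a → IsRationalClass (F i a)) ∧
      (∀ i ⦃a b : ℕ⦄ ⦃x : complexBetti ((fermatHypersurface 1 m).pow (k i) ⊗ W) (2 * q i)⦄, a + b = 2 * q i →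
          IsOfHodgeType (k i + w) ((fermatHypersurface 1 m).pow (k i) ⊗ W) (2 * q i) a b x →
            IsOfHodgeType (dV) (V) (2 * c) (a + e i) (b + e i) (F i x)) ∧
      ∀ z : complexBetti (V) (2 * c), z ∈ ⨆ i, LinearMap.range (F i) := by
  classical
  obtain ⟨ιM, _, kM, qM, eM, hqeM, FM, halgM, hratM, htypM, hsurjM⟩ := hM
  obtain ⟨ι₁, _, k₁, q₁, e₁, hqe₁, F₁, halg₁, hrat₁, htyp₁, hsurj₁⟩ := hP (c - 1)
  obtain ⟨ι₂, _, k₂, q₂, e₂, hqe₂, F₂, halg₂, hrat₂, htyp₂, hsurj₂⟩ := hP (c - 2)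
  -- the composite family, indexed by `ι_M ⊕ (T₁ × ι₁) ⊕ (T₂ × ι₂)` (the exceptional parts only
  -- when `c ≥ 1`, resp. `c ≥ 2`)
  let ι : Type := ιM ⊕ ((PLift (c - 1 + 1 = c) × T₁ × ι₁) ⊕ (PLift (c - 2 + 2 = c) × T₂ × ι₂))
  let k' : ι → ℕ := Sum.elim kM (Sum.elim (fun s ↦ k₁ s.2.2) (fun s ↦ k₂ s.2.2))
  let q' : ι → ℕ := Sum.elim qM (Sum.elim (fun s ↦ q₁ s.2.2) (fun s ↦ q₂ s.2.2))
  let e' : ι → ℕ := Sum.elim eM (Sum.elim (fun s ↦ e₁ s.2.2 + 1) (fun s ↦ e₂ s.2.2 + 2))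
  let F' : ∀ s : ι,
      complexBetti ((fermatHypersurface 1 m).pow (k' s) ⊗ W) (2 * q' s) →ₗ[ℂ] complexBetti V (2 * c) :=
    fun s ↦ match s with
    | Sum.inl i => Ψ ∘ₗ FM i
    | Sum.inr (Sum.inl ⟨⟨h⟩, t, i⟩) => Θ₁ (c - 1) h t ∘ₗ F₁ i
    | Sum.inr (Sum.inr ⟨⟨h⟩, t, i⟩) => Θ₂ (c - 2) h t ∘ₗ F₂ i
  refine ⟨ι, inferInstance, k', q', e', ?_, F', ?_, ?_, ?_, fun z ↦ ?_⟩
  · rintro (i | ⟨⟨h⟩, t, i⟩ | ⟨⟨h⟩, t, i⟩)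
    · exact hqeM i
    · change q₁ i + (e₁ i + 1) = c
      have := hqe₁ i
      omega
    · change q₂ i + (e₂ i + 2) = c
      have := hqe₂ i
      omega
  · rintro (i | ⟨⟨h⟩, t, i⟩ | ⟨⟨h⟩, t, i⟩) a ha
    · exact hΨalg _ (halgM i a ha)
    · exact (hΘ₁ _ h t).1 _ (halg₁ i a ha)
    · exact (hΘ₂ _ h t).1 _ (halg₂ i a ha)
  · rintro (i | ⟨⟨h⟩, t, i⟩ | ⟨⟨h⟩, t, i⟩) a ha
    · exact hΨrat _ (hratM i a ha)
    · exact (hΘ₁ _ h t).2.1 _ (hrat₁ i a ha)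
    · exact (hΘ₂ _ h t).2.1 _ (hrat₂ i a ha)
  · rintro (i | ⟨⟨h⟩, t, i⟩ | ⟨⟨h⟩, t, i⟩) a b x hab hx
    · change a + b = 2 * qM i at hab
      change IsOfHodgeType dV V (2 * c) (a + eM i) (b + eM i) (Ψ (FM i x))
      exact hΨtyp (by have := hqeM i; omega) (htypM i hab hx)
    · change a + b = 2 * q₁ i at hab
      have h2 := (hΘ₁ _ h t).2.2 (by have := hqe₁ i; omega) (htyp₁ i hab hx)
      change IsOfHodgeType dV V (2 * c) (a + (e₁ i + 1)) (b + (e₁ i + 1)) (Θ₁ (c - 1) h t (F₁ i x))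
      rw [← add_assoc, ← add_assoc]
      exact h2
    · change a + b = 2 * q₂ i at hab
      have h2 := (hΘ₂ _ h t).2.2 (by have := hqe₂ i; omega) (htyp₂ i hab hx)
      change IsOfHodgeType dV V (2 * c) (a + (e₂ i + 2)) (b + (e₂ i + 2)) (Θ₂ (c - 2) h t (F₂ i x))
      rw [← add_assoc, ← add_assoc]
      exact h2
  · -- joint surjectivity
    have hΨle : LinearMap.range Ψ ≤ ⨆ s, LinearMap.range (F' s) := by
      rintro _ ⟨x, rfl⟩
      have hx := hsurjM x
      induction hx using Submodule.iSup_induction' with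
      | mem i y hy =>
        obtain ⟨x', rfl⟩ := hy
        exact le_iSup (fun s ↦ LinearMap.range (F' s)) (Sum.inl i) ⟨x', rfl⟩
      | zero => rw [map_zero]; exact Submodule.zero_mem _
      | add y y' _ _ hy hy' => rw [map_add]; exact Submodule.add_mem _ hy hy'
    have h₁le : (⨆ (c₀ : ℕ) (h : c₀ + 1 = c) (t : T₁), LinearMap.range (Θ₁ c₀ h t)) ≤
        ⨆ s, LinearMap.range (F' s) := by
      refine iSup_le fun c₀ ↦ iSup_le fun h ↦ iSup_le fun t ↦ ?_
      obtain rfl : c₀ = c - 1 := by omega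
      rintro _ ⟨y, rfl⟩
      have hy := hsurj₁ y
      induction hy using Submodule.iSup_induction' with
      | mem i y hy =>
        obtain ⟨x', rfl⟩ := hy
        exact le_iSup (fun s ↦ LinearMap.range (F' s)) (Sum.inr (Sum.inl ⟨⟨h⟩, t, i⟩)) ⟨x', rfl⟩
      | zero => rw [map_zero]; exact Submodule.zero_mem _
      | add y y' _ _ hy hy' => rw [map_add]; exact Submodule.add_mem _ hy hy'
    have h₂le : (⨆ (c₀ : ℕ) (h : c₀ + 2 = c) (t : T₂), LinearMap.range (Θ₂ c₀ h t)) ≤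
        ⨆ s, LinearMap.range (F' s) := by
      refine iSup_le fun c₀ ↦ iSup_le fun h ↦ iSup_le fun t ↦ ?_
      obtain rfl : c₀ = c - 2 := by omega
      rintro _ ⟨y, rfl⟩
      have hy := hsurj₂ y
      induction hy using Submodule.iSup_induction' with
      | mem i y hy =>
        obtain ⟨x', rfl⟩ := hy
        exact le_iSup (fun s ↦ LinearMap.range (F' s)) (Sum.inr (Sum.inr ⟨⟨h⟩, t, i⟩)) ⟨x', rfl⟩
      | zero => rw [map_zero]; exact Submodule.zero_mem _
      | add y y' _ _ hy hy' => rw [map_add]; exact Submodule.add_mem _ hy hy'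
    exact sup_le (sup_le hΨle h₁le) h₂le (hsurj z)

end Induction

/-! ### The induction on the dimension, with the two kinds of exceptional hosts -/

section Induction₂

variable {m : ℕ}

/-- **Shioda–Katsura's induction on `r`** with exceptional hosts of shift `1` and `2`
(cf. `exists_family_fermat_tensor`): from the one-step statement `hA` (`X²ₘ` from `X¹ₘ × X¹ₘ`,
centre = points) and `hB` (`X^{r+2}ₘ` from `X^{r+1}ₘ × X¹ₘ`, centre components `Xʳₘ`, `r ≥ 1`), both
`× W` and in even degrees, every `H²ᶜ((X^{r+1}ₘ ⊗ W)(ℂ); ℂ)` carries an admissible dominating family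
from the `C_mᵏ ⊗ W`. Two-step induction exactly as before, the step being `exists_family_of_step₂`.
[cite: ShiodaKatsura1979, §2 Cor. 2.5 (2.9), Thm. 2.10 (proof), Remark 2.11; §3 p. 107–108] -/
theorem exists_family_fermat_tensor₂
    (hA : ∀ (m : ℕ), 1 ≤ m → ∀ (w : ℕ) (W : Motives.SchemeOver ℂ), IsSmoothProjective w W → ∀ (c : ℕ),
    ∃ (Ψ : complexBetti ((fermatHypersurface 1 m ⊗ fermatHypersurface 1 m) ⊗ W) (2 * c) →ₗ[ℂ] complexBetti (fermatHypersurface 2 m ⊗ W) (2 * c))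
      (T₁ : Type) (_ : Fintype T₁) (T₂ : Type) (_ : Fintype T₂)
      (Θ₁ : ∀ c₀ : ℕ, c₀ + 1 = c → T₁ → (complexBetti (W) (2 * c₀) →ₗ[ℂ] complexBetti (fermatHypersurface 2 m ⊗ W) (2 * c)))
      (Θ₂ : ∀ c₀ : ℕ, c₀ + 2 = c → T₂ → (complexBetti (W) (2 * c₀) →ₗ[ℂ] complexBetti (fermatHypersurface 2 m ⊗ W) (2 * c))),
      (∀ x ∈ algebraicClasses ((fermatHypersurface 1 m ⊗ fermatHypersurface 1 m) ⊗ W) c, Ψ x ∈ algebraicClasses (fermatHypersurface 2 m ⊗ W) c) ∧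
      (∀ x, IsRationalClass x → IsRationalClass (Ψ x)) ∧
      (∀ ⦃a b : ℕ⦄ ⦃x⦄, a + b = 2 * c → IsOfHodgeType (2 + w) ((fermatHypersurface 1 m ⊗ fermatHypersurface 1 m) ⊗ W) (2 * c) a b x →
          IsOfHodgeType (2 + w) (fermatHypersurface 2 m ⊗ W) (2 * c) a b (Ψ x)) ∧
      (∀ c₀ (h : c₀ + 1 = c) (t : T₁),
        (∀ y ∈ algebraicClasses (W) c₀, Θ₁ c₀ h t y ∈ algebraicClasses (fermatHypersurface 2 m ⊗ W) c) ∧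
        (∀ y, IsRationalClass y → IsRationalClass (Θ₁ c₀ h t y)) ∧
        (∀ ⦃a b : ℕ⦄ ⦃y⦄, a + b = 2 * c₀ → IsOfHodgeType (w) (W) (2 * c₀) a b y →
            IsOfHodgeType (2 + w) (fermatHypersurface 2 m ⊗ W) (2 * c) (a + 1) (b + 1) (Θ₁ c₀ h t y))) ∧
      (∀ c₀ (h : c₀ + 2 = c) (t : T₂),
        (∀ y ∈ algebraicClasses (W) c₀, Θ₂ c₀ h t y ∈ algebraicClasses (fermatHypersurface 2 m ⊗ W) c) ∧
        (∀ y, IsRationalClass y → IsRationalClass (Θ₂ c₀ h t y)) ∧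
        (∀ ⦃a b : ℕ⦄ ⦃y⦄, a + b = 2 * c₀ → IsOfHodgeType (w) (W) (2 * c₀) a b y →
            IsOfHodgeType (2 + w) (fermatHypersurface 2 m ⊗ W) (2 * c) (a + 2) (b + 2) (Θ₂ c₀ h t y))) ∧
      ∀ z : complexBetti (fermatHypersurface 2 m ⊗ W) (2 * c),
        z ∈ LinearMap.range Ψ ⊔ (⨆ (c₀ : ℕ) (h : c₀ + 1 = c) (t : T₁), LinearMap.range (Θ₁ c₀ h t)) ⊔
          ⨆ (c₀ : ℕ) (h : c₀ + 2 = c) (t : T₂), LinearMap.range (Θ₂ c₀ h t))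
    (hB : ∀ (m r : ℕ), 1 ≤ m → 1 ≤ r → ∀ (w : ℕ) (W : Motives.SchemeOver ℂ), IsSmoothProjective w W →
    ∀ (c : ℕ),
    ∃ (Ψ : complexBetti ((fermatHypersurface (r + 1) m ⊗ fermatHypersurface 1 m) ⊗ W) (2 * c) →ₗ[ℂ] complexBetti (fermatHypersurface (r + 2) m ⊗ W) (2 * c))
      (T₁ : Type) (_ : Fintype T₁) (T₂ : Type) (_ : Fintype T₂)
      (Θ₁ : ∀ c₀ : ℕ, c₀ + 1 = c → T₁ → (complexBetti (fermatHypersurface r m ⊗ W) (2 * c₀) →ₗ[ℂ] complexBetti (fermatHypersurface (r + 2) m ⊗ W) (2 * c)))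
      (Θ₂ : ∀ c₀ : ℕ, c₀ + 2 = c → T₂ → (complexBetti (fermatHypersurface r m ⊗ W) (2 * c₀) →ₗ[ℂ] complexBetti (fermatHypersurface (r + 2) m ⊗ W) (2 * c))),
      (∀ x ∈ algebraicClasses ((fermatHypersurface (r + 1) m ⊗ fermatHypersurface 1 m) ⊗ W) c, Ψ x ∈ algebraicClasses (fermatHypersurface (r + 2) m ⊗ W) c) ∧
      (∀ x, IsRationalClass x → IsRationalClass (Ψ x)) ∧
      (∀ ⦃a b : ℕ⦄ ⦃x⦄, a + b = 2 * c → IsOfHodgeType (r + 2 + w) ((fermatHypersurface (r + 1) m ⊗ fermatHypersurface 1 m) ⊗ W) (2 * c) a b x →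
          IsOfHodgeType (r + 2 + w) (fermatHypersurface (r + 2) m ⊗ W) (2 * c) a b (Ψ x)) ∧
      (∀ c₀ (h : c₀ + 1 = c) (t : T₁),
        (∀ y ∈ algebraicClasses (fermatHypersurface r m ⊗ W) c₀, Θ₁ c₀ h t y ∈ algebraicClasses (fermatHypersurface (r + 2) m ⊗ W) c) ∧
        (∀ y, IsRationalClass y → IsRationalClass (Θ₁ c₀ h t y)) ∧
        (∀ ⦃a b : ℕ⦄ ⦃y⦄, a + b = 2 * c₀ → IsOfHodgeType (r + w) (fermatHypersurface r m ⊗ W) (2 * c₀) a b y →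
            IsOfHodgeType (r + 2 + w) (fermatHypersurface (r + 2) m ⊗ W) (2 * c) (a + 1) (b + 1) (Θ₁ c₀ h t y))) ∧
      (∀ c₀ (h : c₀ + 2 = c) (t : T₂),
        (∀ y ∈ algebraicClasses (fermatHypersurface r m ⊗ W) c₀, Θ₂ c₀ h t y ∈ algebraicClasses (fermatHypersurface (r + 2) m ⊗ W) c) ∧
        (∀ y, IsRationalClass y → IsRationalClass (Θ₂ c₀ h t y)) ∧
        (∀ ⦃a b : ℕ⦄ ⦃y⦄, a + b = 2 * c₀ → IsOfHodgeType (r + w) (fermatHypersurface r m ⊗ W) (2 * c₀) a b y →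
            IsOfHodgeType (r + 2 + w) (fermatHypersurface (r + 2) m ⊗ W) (2 * c) (a + 2) (b + 2) (Θ₂ c₀ h t y))) ∧
      ∀ z : complexBetti (fermatHypersurface (r + 2) m ⊗ W) (2 * c),
        z ∈ LinearMap.range Ψ ⊔ (⨆ (c₀ : ℕ) (h : c₀ + 1 = c) (t : T₁), LinearMap.range (Θ₁ c₀ h t)) ⊔
          ⨆ (c₀ : ℕ) (h : c₀ + 2 = c) (t : T₂), LinearMap.range (Θ₂ c₀ h t))
    (hm : 1 ≤ m) (r : ℕ) {w : ℕ} {W : Motives.SchemeOver ℂ} (hW : IsSmoothProjective w W) (c : ℕ) :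
    ∃ (ι : Type) (_ : Fintype ι) (k q e : ι → ℕ) (_ : ∀ i, q i + e i = c)
      (F : ∀ i, complexBetti ((fermatHypersurface 1 m).pow (k i) ⊗ W) (2 * q i) →ₗ[ℂ] complexBetti (fermatHypersurface (r + 1) m ⊗ W) (2 * c)),
      (∀ i, ∀ a ∈ algebraicClasses ((fermatHypersurface 1 m).pow (k i) ⊗ W) (q i), F i a ∈ algebraicClasses (fermatHypersurface (r + 1) m ⊗ W) c) ∧
      (∀ i a, IsRationalClass a → IsRationalClass (F i a)) ∧
      (∀ i ⦃a b : ℕ⦄ ⦃x : complexBetti ((fermatHypersurface 1 m).pow (k i) ⊗ W) (2 * q i)⦄, a + b = 2 * q i →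
          IsOfHodgeType (k i + w) ((fermatHypersurface 1 m).pow (k i) ⊗ W) (2 * q i) a b x →
            IsOfHodgeType (r + 1 + w) (fermatHypersurface (r + 1) m ⊗ W) (2 * c) (a + e i) (b + e i) (F i x)) ∧
      ∀ z : complexBetti (fermatHypersurface (r + 1) m ⊗ W) (2 * c), z ∈ ⨆ i, LinearMap.range (F i) := by
  have hC : IsSmoothProjective 1 (fermatHypersurface 1 m) := isSmoothProjective_fermatHypersurface le_rfl hm
  -- two-step induction on `r`, for all `W` and `c` at once
  suffices key : ∀ r : ℕ,
      (∀ {w : ℕ} {W : Motives.SchemeOver ℂ}, IsSmoothProjective w W → ∀ c : ℕ,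
        ∃ (ι : Type) (_ : Fintype ι) (k q e : ι → ℕ) (_ : ∀ i, q i + e i = c)
          (F : ∀ i, complexBetti ((fermatHypersurface 1 m).pow (k i) ⊗ W) (2 * q i) →ₗ[ℂ] complexBetti (fermatHypersurface (r + 1) m ⊗ W) (2 * c)),
          (∀ i, ∀ a ∈ algebraicClasses ((fermatHypersurface 1 m).pow (k i) ⊗ W) (q i), F i a ∈ algebraicClasses (fermatHypersurface (r + 1) m ⊗ W) c) ∧
          (∀ i a, IsRationalClass a → IsRationalClass (F i a)) ∧
          (∀ i ⦃a b : ℕ⦄ ⦃x : complexBetti ((fermatHypersurface 1 m).pow (k i) ⊗ W) (2 * q i)⦄, a + b = 2 * q i →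
              IsOfHodgeType (k i + w) ((fermatHypersurface 1 m).pow (k i) ⊗ W) (2 * q i) a b x →
                IsOfHodgeType (r + 1 + w) (fermatHypersurface (r + 1) m ⊗ W) (2 * c) (a + e i) (b + e i) (F i x)) ∧
          ∀ z : complexBetti (fermatHypersurface (r + 1) m ⊗ W) (2 * c), z ∈ ⨆ i, LinearMap.range (F i)) ∧
      (∀ {w : ℕ} {W : Motives.SchemeOver ℂ}, IsSmoothProjective w W → ∀ c : ℕ,
        ∃ (ι : Type) (_ : Fintype ι) (k q e : ι → ℕ) (_ : ∀ i, q i + e i = c)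
          (F : ∀ i, complexBetti ((fermatHypersurface 1 m).pow (k i) ⊗ W) (2 * q i) →ₗ[ℂ] complexBetti (fermatHypersurface (r + 2) m ⊗ W) (2 * c)),
          (∀ i, ∀ a ∈ algebraicClasses ((fermatHypersurface 1 m).pow (k i) ⊗ W) (q i), F i a ∈ algebraicClasses (fermatHypersurface (r + 2) m ⊗ W) c) ∧
          (∀ i a, IsRationalClass a → IsRationalClass (F i a)) ∧
          (∀ i ⦃a b : ℕ⦄ ⦃x : complexBetti ((fermatHypersurface 1 m).pow (k i) ⊗ W) (2 * q i)⦄, a + b = 2 * q i →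
              IsOfHodgeType (k i + w) ((fermatHypersurface 1 m).pow (k i) ⊗ W) (2 * q i) a b x →
                IsOfHodgeType (r + 2 + w) (fermatHypersurface (r + 2) m ⊗ W) (2 * c) (a + e i) (b + e i) (F i x)) ∧
          ∀ z : complexBetti (fermatHypersurface (r + 2) m ⊗ W) (2 * c), z ∈ ⨆ i, LinearMap.range (F i)) from
    (key r).1 hW c
  intro r
  induction r with
  | zero =>
    refine ⟨fun {w W} hW c ↦ ?_, fun {w W} hW c ↦ ?_⟩
    · -- `r = 0`: the curve
      have h := exists_family_curve (m := m) W w c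
      rw [show 0 + 1 + w = 1 + w by omega]
      exact h
    · -- `r = 1`: the Fermat surface, `hA`
      obtain ⟨Ψ, T₁, _, T₂, _, Θ₁, Θ₂, hΨalg, hΨrat, hΨtyp, hΘ₁, hΘ₂, hsurj⟩ := hA m hm w W hW c
      have hM :
          ∃ (ι : Type) (_ : Fintype ι) (k q e : ι → ℕ) (_ : ∀ i, q i + e i = c)
            (F : ∀ i, complexBetti ((fermatHypersurface 1 m).pow (k i) ⊗ W) (2 * q i) →ₗ[ℂ] complexBetti ((fermatHypersurface 1 m ⊗ fermatHypersurface 1 m) ⊗ W) (2 * c)),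
            (∀ i, ∀ a ∈ algebraicClasses ((fermatHypersurface 1 m).pow (k i) ⊗ W) (q i), F i a ∈ algebraicClasses ((fermatHypersurface 1 m ⊗ fermatHypersurface 1 m) ⊗ W) c) ∧
            (∀ i a, IsRationalClass a → IsRationalClass (F i a)) ∧
            (∀ i ⦃a b : ℕ⦄ ⦃x : complexBetti ((fermatHypersurface 1 m).pow (k i) ⊗ W) (2 * q i)⦄, a + b = 2 * q i →
                IsOfHodgeType (k i + w) ((fermatHypersurface 1 m).pow (k i) ⊗ W) (2 * q i) a b x →
                  IsOfHodgeType (2 + w) ((fermatHypersurface 1 m ⊗ fermatHypersurface 1 m) ⊗ W) (2 * c) (a + e i) (b + e i) (F i x)) ∧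
            ∀ z : complexBetti ((fermatHypersurface 1 m ⊗ fermatHypersurface 1 m) ⊗ W) (2 * c), z ∈ ⨆ i, LinearMap.range (F i) := by
        refine exists_family_of_tensor (exists_family_of_iso (α_ _ _ _) (by omega)
          (exists_family_curve (m := m) (fermatHypersurface 1 m ⊗ W) (1 + w) c))
      have h := exists_family_of_step₂ Ψ Θ₁ Θ₂ hΨalg hΨrat hΨtyp hΘ₁ hΘ₂ hsurj hM
        (fun c₀ ↦ exists_family_unit (m := m) W w c₀)
      rw [show 0 + 2 + w = 2 + w by omega]
      exact h
  | succ r ih =>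
    refine ⟨ih.2, fun {w W} hW c ↦ ?_⟩
    -- `r + 3`: `hB` at `r + 1 ≥ 1`
    obtain ⟨Ψ, T₁, _, T₂, _, Θ₁, Θ₂, hΨalg, hΨrat, hΨtyp, hΘ₁, hΘ₂, hsurj⟩ :=
      hB m (r + 1) hm (by omega) w W hW c
    have hCW : IsSmoothProjective (1 + w) (fermatHypersurface 1 m ⊗ W) := IsSmoothProjective.tensor_holds hC hW
    have hM :
          ∃ (ι : Type) (_ : Fintype ι) (k q e : ι → ℕ) (_ : ∀ i, q i + e i = c)
            (F : ∀ i, complexBetti ((fermatHypersurface 1 m).pow (k i) ⊗ W) (2 * q i) →ₗ[ℂ] complexBetti ((fermatHypersurface (r + 1 + 1) m ⊗ fermatHypersurface 1 m) ⊗ W) (2 * c)),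
            (∀ i, ∀ a ∈ algebraicClasses ((fermatHypersurface 1 m).pow (k i) ⊗ W) (q i), F i a ∈ algebraicClasses ((fermatHypersurface (r + 1 + 1) m ⊗ fermatHypersurface 1 m) ⊗ W) c) ∧
            (∀ i a, IsRationalClass a → IsRationalClass (F i a)) ∧
            (∀ i ⦃a b : ℕ⦄ ⦃x : complexBetti ((fermatHypersurface 1 m).pow (k i) ⊗ W) (2 * q i)⦄, a + b = 2 * q i →
                IsOfHodgeType (k i + w) ((fermatHypersurface 1 m).pow (k i) ⊗ W) (2 * q i) a b x →
                  IsOfHodgeType (r + 1 + 2 + w) ((fermatHypersurface (r + 1 + 1) m ⊗ fermatHypersurface 1 m) ⊗ W) (2 * c) (a + e i) (b + e i) (F i x)) ∧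
            ∀ z : complexBetti ((fermatHypersurface (r + 1 + 1) m ⊗ fermatHypersurface 1 m) ⊗ W) (2 * c), z ∈ ⨆ i, LinearMap.range (F i) := by
      refine exists_family_of_tensor (exists_family_of_iso (α_ _ _ _) (by omega) (ih.2 hCW c))
    have h := exists_family_of_step₂ Ψ Θ₁ Θ₂ hΨalg hΨrat hΨtyp hΘ₁ hΘ₂ hsurj hM (fun c₀ ↦ ?_)
    · rw [show r + 1 + 2 + w = r + 1 + 2 + w from rfl]
      exact h
    · have h' := ih.1 hW c₀
      rw [show r + 1 + w = r + 1 + w from rfl]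
      exact h'

/-- **Every `H²ᶜ(Xⁿₘ(ℂ); ℂ)`, `n ≥ 1`, carries an admissible dominating family from the powers of the
Fermat curve**, granted the one-step statement with the two kinds of exceptional hosts
(`exists_family_fermat_tensor₂` at `W = Spec ℂ`, right unitors removed as in `exists_family_fermat`).
[cite: ShiodaKatsura1979, §2 Cor. 2.5 (2.9), Remark 2.11; §3 p. 107–108] -/
theorem exists_family_fermat₂
    (hA : ∀ (m : ℕ), 1 ≤ m → ∀ (w : ℕ) (W : Motives.SchemeOver ℂ), IsSmoothProjective w W → ∀ (c : ℕ),
    ∃ (Ψ : complexBetti ((fermatHypersurface 1 m ⊗ fermatHypersurface 1 m) ⊗ W) (2 * c) →ₗ[ℂ] complexBetti (fermatHypersurface 2 m ⊗ W) (2 * c))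
      (T₁ : Type) (_ : Fintype T₁) (T₂ : Type) (_ : Fintype T₂)
      (Θ₁ : ∀ c₀ : ℕ, c₀ + 1 = c → T₁ → (complexBetti (W) (2 * c₀) →ₗ[ℂ] complexBetti (fermatHypersurface 2 m ⊗ W) (2 * c)))
      (Θ₂ : ∀ c₀ : ℕ, c₀ + 2 = c → T₂ → (complexBetti (W) (2 * c₀) →ₗ[ℂ] complexBetti (fermatHypersurface 2 m ⊗ W) (2 * c))),
      (∀ x ∈ algebraicClasses ((fermatHypersurface 1 m ⊗ fermatHypersurface 1 m) ⊗ W) c, Ψ x ∈ algebraicClasses (fermatHypersurface 2 m ⊗ W) c) ∧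
      (∀ x, IsRationalClass x → IsRationalClass (Ψ x)) ∧
      (∀ ⦃a b : ℕ⦄ ⦃x⦄, a + b = 2 * c → IsOfHodgeType (2 + w) ((fermatHypersurface 1 m ⊗ fermatHypersurface 1 m) ⊗ W) (2 * c) a b x →
          IsOfHodgeType (2 + w) (fermatHypersurface 2 m ⊗ W) (2 * c) a b (Ψ x)) ∧
      (∀ c₀ (h : c₀ + 1 = c) (t : T₁),
        (∀ y ∈ algebraicClasses (W) c₀, Θ₁ c₀ h t y ∈ algebraicClasses (fermatHypersurface 2 m ⊗ W) c) ∧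
        (∀ y, IsRationalClass y → IsRationalClass (Θ₁ c₀ h t y)) ∧
        (∀ ⦃a b : ℕ⦄ ⦃y⦄, a + b = 2 * c₀ → IsOfHodgeType (w) (W) (2 * c₀) a b y →
            IsOfHodgeType (2 + w) (fermatHypersurface 2 m ⊗ W) (2 * c) (a + 1) (b + 1) (Θ₁ c₀ h t y))) ∧
      (∀ c₀ (h : c₀ + 2 = c) (t : T₂),
        (∀ y ∈ algebraicClasses (W) c₀, Θ₂ c₀ h t y ∈ algebraicClasses (fermatHypersurface 2 m ⊗ W) c) ∧
        (∀ y, IsRationalClass y → IsRationalClass (Θ₂ c₀ h t y)) ∧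
        (∀ ⦃a b : ℕ⦄ ⦃y⦄, a + b = 2 * c₀ → IsOfHodgeType (w) (W) (2 * c₀) a b y →
            IsOfHodgeType (2 + w) (fermatHypersurface 2 m ⊗ W) (2 * c) (a + 2) (b + 2) (Θ₂ c₀ h t y))) ∧
      ∀ z : complexBetti (fermatHypersurface 2 m ⊗ W) (2 * c),
        z ∈ LinearMap.range Ψ ⊔ (⨆ (c₀ : ℕ) (h : c₀ + 1 = c) (t : T₁), LinearMap.range (Θ₁ c₀ h t)) ⊔
          ⨆ (c₀ : ℕ) (h : c₀ + 2 = c) (t : T₂), LinearMap.range (Θ₂ c₀ h t))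
    (hB : ∀ (m r : ℕ), 1 ≤ m → 1 ≤ r → ∀ (w : ℕ) (W : Motives.SchemeOver ℂ), IsSmoothProjective w W →
    ∀ (c : ℕ),
    ∃ (Ψ : complexBetti ((fermatHypersurface (r + 1) m ⊗ fermatHypersurface 1 m) ⊗ W) (2 * c) →ₗ[ℂ] complexBetti (fermatHypersurface (r + 2) m ⊗ W) (2 * c))
      (T₁ : Type) (_ : Fintype T₁) (T₂ : Type) (_ : Fintype T₂)
      (Θ₁ : ∀ c₀ : ℕ, c₀ + 1 = c → T₁ → (complexBetti (fermatHypersurface r m ⊗ W) (2 * c₀) →ₗ[ℂ] complexBetti (fermatHypersurface (r + 2) m ⊗ W) (2 * c)))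
      (Θ₂ : ∀ c₀ : ℕ, c₀ + 2 = c → T₂ → (complexBetti (fermatHypersurface r m ⊗ W) (2 * c₀) →ₗ[ℂ] complexBetti (fermatHypersurface (r + 2) m ⊗ W) (2 * c))),
      (∀ x ∈ algebraicClasses ((fermatHypersurface (r + 1) m ⊗ fermatHypersurface 1 m) ⊗ W) c, Ψ x ∈ algebraicClasses (fermatHypersurface (r + 2) m ⊗ W) c) ∧
      (∀ x, IsRationalClass x → IsRationalClass (Ψ x)) ∧
      (∀ ⦃a b : ℕ⦄ ⦃x⦄, a + b = 2 * c → IsOfHodgeType (r + 2 + w) ((fermatHypersurface (r + 1) m ⊗ fermatHypersurface 1 m) ⊗ W) (2 * c) a b x →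
          IsOfHodgeType (r + 2 + w) (fermatHypersurface (r + 2) m ⊗ W) (2 * c) a b (Ψ x)) ∧
      (∀ c₀ (h : c₀ + 1 = c) (t : T₁),
        (∀ y ∈ algebraicClasses (fermatHypersurface r m ⊗ W) c₀, Θ₁ c₀ h t y ∈ algebraicClasses (fermatHypersurface (r + 2) m ⊗ W) c) ∧
        (∀ y, IsRationalClass y → IsRationalClass (Θ₁ c₀ h t y)) ∧
        (∀ ⦃a b : ℕ⦄ ⦃y⦄, a + b = 2 * c₀ → IsOfHodgeType (r + w) (fermatHypersurface r m ⊗ W) (2 * c₀) a b y →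
            IsOfHodgeType (r + 2 + w) (fermatHypersurface (r + 2) m ⊗ W) (2 * c) (a + 1) (b + 1) (Θ₁ c₀ h t y))) ∧
      (∀ c₀ (h : c₀ + 2 = c) (t : T₂),
        (∀ y ∈ algebraicClasses (fermatHypersurface r m ⊗ W) c₀, Θ₂ c₀ h t y ∈ algebraicClasses (fermatHypersurface (r + 2) m ⊗ W) c) ∧
        (∀ y, IsRationalClass y → IsRationalClass (Θ₂ c₀ h t y)) ∧
        (∀ ⦃a b : ℕ⦄ ⦃y⦄, a + b = 2 * c₀ → IsOfHodgeType (r + w) (fermatHypersurface r m ⊗ W) (2 * c₀) a b y →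
            IsOfHodgeType (r + 2 + w) (fermatHypersurface (r + 2) m ⊗ W) (2 * c) (a + 2) (b + 2) (Θ₂ c₀ h t y))) ∧
      ∀ z : complexBetti (fermatHypersurface (r + 2) m ⊗ W) (2 * c),
        z ∈ LinearMap.range Ψ ⊔ (⨆ (c₀ : ℕ) (h : c₀ + 1 = c) (t : T₁), LinearMap.range (Θ₁ c₀ h t)) ⊔
          ⨆ (c₀ : ℕ) (h : c₀ + 2 = c) (t : T₂), LinearMap.range (Θ₂ c₀ h t))
    (hm : 1 ≤ m) {n : ℕ} (hn : 1 ≤ n) (c : ℕ) :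
    ∃ (ι : Type) (_ : Fintype ι) (k q e : ι → ℕ) (_ : ∀ i, q i + e i = c)
      (F : ∀ i, complexBetti ((fermatHypersurface 1 m).pow (k i)) (2 * q i) →ₗ[ℂ] complexBetti (fermatHypersurface n m) (2 * c)),
      (∀ i, ∀ a ∈ algebraicClasses ((fermatHypersurface 1 m).pow (k i)) (q i), F i a ∈ algebraicClasses (fermatHypersurface n m) c) ∧
      (∀ i a, IsRationalClass a → IsRationalClass (F i a)) ∧
      (∀ i ⦃a b : ℕ⦄ ⦃x : complexBetti ((fermatHypersurface 1 m).pow (k i)) (2 * q i)⦄, a + b = 2 * q i →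
          IsOfHodgeType (k i) ((fermatHypersurface 1 m).pow (k i)) (2 * q i) a b x →
            IsOfHodgeType n (fermatHypersurface n m) (2 * c) (a + e i) (b + e i) (F i x)) ∧
      ∀ z : complexBetti (fermatHypersurface n m) (2 * c), z ∈ ⨆ i, LinearMap.range (F i) := by
  obtain ⟨r, rfl⟩ : ∃ r, n = r + 1 := ⟨n - 1, by omega⟩
  obtain ⟨ι, _, k, q, e, hqe, F, halg, hrat, htyp, hsurj⟩ :=
    exists_family_of_iso (ρ_ (fermatHypersurface (r + 1) m)).symm (show r + 1 + 0 = r + 1 by omega)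
      (exists_family_fermat_tensor₂ hA hB hm r (isSmoothProjective_unit_holds ℂ) c)
  refine ⟨ι, inferInstance, k, q, e, hqe,
    fun i ↦ F i ∘ₗ (complexBetti.map (ρ_ ((fermatHypersurface 1 m).pow (k i))).hom (2 * q i)).hom,
    fun i a ha ↦ ?_, fun i a ha ↦ ?_, fun i a b x hab hx ↦ ?_, fun z ↦ ?_⟩
  · exact halg i _ ((mem_algebraicClasses_map_iff_of_iso (ρ_ _)).2 ha)
  · exact hrat i _ (ha.map _)
  · refine htyp i hab ?_
    rw [Nat.add_zero]
    exact hx.map_of_iso (ρ_ _)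
  · have hz := hsurj z
    induction hz using Submodule.iSup_induction' with
    | mem i y hy =>
      obtain ⟨x, rfl⟩ := hy
      obtain ⟨x', rfl⟩ := surjective_complexBetti_map_of_iso
        (ρ_ ((fermatHypersurface 1 m).pow (k i))) (2 * q i) x
      exact Submodule.mem_iSup_of_mem i ⟨x', rfl⟩
    | zero => exact Submodule.zero_mem _
    | add y y' _ _ hy hy' => exact Submodule.add_mem _ hy hy'

/-- **`FermatHodgeClassesLiftToCurvePowersSum` from ONE STEP of the inductive structure, the
centre components acting with shifts `1` and `2`** (cf.
`FermatHodgeClassesLiftToCurvePowersSum_of_inductiveStep`): the dominating family of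
`exists_family_fermat₂` at `(m, 2p, p)` fed to `FermatHodgeClassesLiftToCurvePowersSum_of_families`
(Hodge classes lift along it by Voisin 2025, Cor. 2.12, proved).
[cite: ShiodaKatsura1979, §1 Thm. 1.7 (1.25), Remark 1.9; §2 Lemma 2.1, Prop. 2.4 (2.5), Cor. 2.5 (2.9), (2.17)–(2.19), Thm. 2.10; §3 p. 107–108]
[cite: Voisin2025, Prop. 2.11 and Cor. 2.12] [cite: VoisinHodgeI2002, Thm. 7.31, Lemma 7.32 and §7.3.2] -/
theorem FermatHodgeClassesLiftToCurvePowersSum_of_inductiveStep₂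
    (hA : ∀ (m : ℕ), 1 ≤ m → ∀ (w : ℕ) (W : Motives.SchemeOver ℂ), IsSmoothProjective w W → ∀ (c : ℕ),
    ∃ (Ψ : complexBetti ((fermatHypersurface 1 m ⊗ fermatHypersurface 1 m) ⊗ W) (2 * c) →ₗ[ℂ] complexBetti (fermatHypersurface 2 m ⊗ W) (2 * c))
      (T₁ : Type) (_ : Fintype T₁) (T₂ : Type) (_ : Fintype T₂)
      (Θ₁ : ∀ c₀ : ℕ, c₀ + 1 = c → T₁ → (complexBetti (W) (2 * c₀) →ₗ[ℂ] complexBetti (fermatHypersurface 2 m ⊗ W) (2 * c)))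
      (Θ₂ : ∀ c₀ : ℕ, c₀ + 2 = c → T₂ → (complexBetti (W) (2 * c₀) →ₗ[ℂ] complexBetti (fermatHypersurface 2 m ⊗ W) (2 * c))),
      (∀ x ∈ algebraicClasses ((fermatHypersurface 1 m ⊗ fermatHypersurface 1 m) ⊗ W) c, Ψ x ∈ algebraicClasses (fermatHypersurface 2 m ⊗ W) c) ∧
      (∀ x, IsRationalClass x → IsRationalClass (Ψ x)) ∧
      (∀ ⦃a b : ℕ⦄ ⦃x⦄, a + b = 2 * c → IsOfHodgeType (2 + w) ((fermatHypersurface 1 m ⊗ fermatHypersurface 1 m) ⊗ W) (2 * c) a b x →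
          IsOfHodgeType (2 + w) (fermatHypersurface 2 m ⊗ W) (2 * c) a b (Ψ x)) ∧
      (∀ c₀ (h : c₀ + 1 = c) (t : T₁),
        (∀ y ∈ algebraicClasses (W) c₀, Θ₁ c₀ h t y ∈ algebraicClasses (fermatHypersurface 2 m ⊗ W) c) ∧
        (∀ y, IsRationalClass y → IsRationalClass (Θ₁ c₀ h t y)) ∧
        (∀ ⦃a b : ℕ⦄ ⦃y⦄, a + b = 2 * c₀ → IsOfHodgeType (w) (W) (2 * c₀) a b y →
            IsOfHodgeType (2 + w) (fermatHypersurface 2 m ⊗ W) (2 * c) (a + 1) (b + 1) (Θ₁ c₀ h t y))) ∧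
      (∀ c₀ (h : c₀ + 2 = c) (t : T₂),
        (∀ y ∈ algebraicClasses (W) c₀, Θ₂ c₀ h t y ∈ algebraicClasses (fermatHypersurface 2 m ⊗ W) c) ∧
        (∀ y, IsRationalClass y → IsRationalClass (Θ₂ c₀ h t y)) ∧
        (∀ ⦃a b : ℕ⦄ ⦃y⦄, a + b = 2 * c₀ → IsOfHodgeType (w) (W) (2 * c₀) a b y →
            IsOfHodgeType (2 + w) (fermatHypersurface 2 m ⊗ W) (2 * c) (a + 2) (b + 2) (Θ₂ c₀ h t y))) ∧
      ∀ z : complexBetti (fermatHypersurface 2 m ⊗ W) (2 * c),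
        z ∈ LinearMap.range Ψ ⊔ (⨆ (c₀ : ℕ) (h : c₀ + 1 = c) (t : T₁), LinearMap.range (Θ₁ c₀ h t)) ⊔
          ⨆ (c₀ : ℕ) (h : c₀ + 2 = c) (t : T₂), LinearMap.range (Θ₂ c₀ h t))
    (hB : ∀ (m r : ℕ), 1 ≤ m → 1 ≤ r → ∀ (w : ℕ) (W : Motives.SchemeOver ℂ), IsSmoothProjective w W →
    ∀ (c : ℕ),
    ∃ (Ψ : complexBetti ((fermatHypersurface (r + 1) m ⊗ fermatHypersurface 1 m) ⊗ W) (2 * c) →ₗ[ℂ] complexBetti (fermatHypersurface (r + 2) m ⊗ W) (2 * c))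
      (T₁ : Type) (_ : Fintype T₁) (T₂ : Type) (_ : Fintype T₂)
      (Θ₁ : ∀ c₀ : ℕ, c₀ + 1 = c → T₁ → (complexBetti (fermatHypersurface r m ⊗ W) (2 * c₀) →ₗ[ℂ] complexBetti (fermatHypersurface (r + 2) m ⊗ W) (2 * c)))
      (Θ₂ : ∀ c₀ : ℕ, c₀ + 2 = c → T₂ → (complexBetti (fermatHypersurface r m ⊗ W) (2 * c₀) →ₗ[ℂ] complexBetti (fermatHypersurface (r + 2) m ⊗ W) (2 * c))),
      (∀ x ∈ algebraicClasses ((fermatHypersurface (r + 1) m ⊗ fermatHypersurface 1 m) ⊗ W) c, Ψ x ∈ algebraicClasses (fermatHypersurface (r + 2) m ⊗ W) c) ∧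
      (∀ x, IsRationalClass x → IsRationalClass (Ψ x)) ∧
      (∀ ⦃a b : ℕ⦄ ⦃x⦄, a + b = 2 * c → IsOfHodgeType (r + 2 + w) ((fermatHypersurface (r + 1) m ⊗ fermatHypersurface 1 m) ⊗ W) (2 * c) a b x →
          IsOfHodgeType (r + 2 + w) (fermatHypersurface (r + 2) m ⊗ W) (2 * c) a b (Ψ x)) ∧
      (∀ c₀ (h : c₀ + 1 = c) (t : T₁),
        (∀ y ∈ algebraicClasses (fermatHypersurface r m ⊗ W) c₀, Θ₁ c₀ h t y ∈ algebraicClasses (fermatHypersurface (r + 2) m ⊗ W) c) ∧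
        (∀ y, IsRationalClass y → IsRationalClass (Θ₁ c₀ h t y)) ∧
        (∀ ⦃a b : ℕ⦄ ⦃y⦄, a + b = 2 * c₀ → IsOfHodgeType (r + w) (fermatHypersurface r m ⊗ W) (2 * c₀) a b y →
            IsOfHodgeType (r + 2 + w) (fermatHypersurface (r + 2) m ⊗ W) (2 * c) (a + 1) (b + 1) (Θ₁ c₀ h t y))) ∧
      (∀ c₀ (h : c₀ + 2 = c) (t : T₂),
        (∀ y ∈ algebraicClasses (fermatHypersurface r m ⊗ W) c₀, Θ₂ c₀ h t y ∈ algebraicClasses (fermatHypersurface (r + 2) m ⊗ W) c) ∧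
        (∀ y, IsRationalClass y → IsRationalClass (Θ₂ c₀ h t y)) ∧
        (∀ ⦃a b : ℕ⦄ ⦃y⦄, a + b = 2 * c₀ → IsOfHodgeType (r + w) (fermatHypersurface r m ⊗ W) (2 * c₀) a b y →
            IsOfHodgeType (r + 2 + w) (fermatHypersurface (r + 2) m ⊗ W) (2 * c) (a + 2) (b + 2) (Θ₂ c₀ h t y))) ∧
      ∀ z : complexBetti (fermatHypersurface (r + 2) m ⊗ W) (2 * c),
        z ∈ LinearMap.range Ψ ⊔ (⨆ (c₀ : ℕ) (h : c₀ + 1 = c) (t : T₁), LinearMap.range (Θ₁ c₀ h t)) ⊔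
          ⨆ (c₀ : ℕ) (h : c₀ + 2 = c) (t : T₂), LinearMap.range (Θ₂ c₀ h t)) :
    FermatHodgeClassesLiftToCurvePowersSum :=
  FermatHodgeClassesLiftToCurvePowersSum_of_families fun m p hm hp ↦ by
    obtain ⟨ι, _, k, q, e, hqe, F, halg, hrat, htyp, hsurj⟩ :=
      exists_family_fermat₂ hA hB hm (n := 2 * p) (by omega) p
    exact ⟨ι, inferInstance, k, q, e, F, hqe, halg, hrat, htyp, fun c _ _ ↦ hsurj c⟩

end Induction₂

/-! ### The clause of the step from the spans of the diagram, with the two kinds of exceptional hosts -/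

section Spans

/-- **One clause of the one-step statement (two kinds of exceptional hosts) from SPANS.** Given the
target `V` (dimension `dV`), the main host `M` (same dimension), a centre component `P` (dimension
`dP`, `dP + 2 = dV`) and: a span `M ←b— Z —f→ V` with `dim Z = dV` such that `f_* ∘ b^*` carries
algebraic classes to algebraic classes (`hbalg`); finitely many spans `P ←πₜ— Eₜ —gₜ→ V` with
`dim Eₜ = dP + 1` and FLAT `πₜ` (shift `1`); finitely many morphisms `sₜ : P ⟶ V` (shift `2`: the
push-forwards `(σₜ ≫ jₜ ≫ f)_*` of the sections of the exceptional bundles); and the joint surjectivity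
`H²ᶜ(V) = im f_*b^* + Σₜ im gₜ,*πₜ^* + Σₜ im sₜ,*` — the clause holds at `(V, M, P, c)`, with
`Ψ = u • f_* b^*`, `Θ₁,ₜ = uₜ • gₜ,* πₜ^*`, `Θ₂,ₜ = uₜ' • sₜ,*` (orientation scalars making them defined
over `ℚ`): push-forwards carry algebraic classes to algebraic classes with the codimension shift
(`complexGysin_mem_algebraicClasses`, `complexGysin_map_mem_algebraicClasses_of_flat`), and all three
are rational Hodge-linear of bidegree `(0,0)`, `(1,1)`, `(2,2)` (`isRationalHodgeMap_complexGysin_comp_map`).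
[cite: ShiodaKatsura1979, §1 Thm. 1.7 (1.25); §2 Lemma 2.1, Prop. 2.4 (2.5), Cor. 2.5 (2.9), (2.17)–(2.19)]
[cite: VoisinHodgeI2002, §7.3.2 and Lemma 7.32] [cite: FultonYoungTableaux1997, Appendix B §B.2 Exercise 5] -/
theorem inductiveStepClause₂_of_spans (μ : OrientationFamily) {V M P Z : Motives.SchemeOver ℂ}
    {dV dP : ℕ} (hV : IsSmoothProjective dV V) (hM : IsSmoothProjective dV M)
    (hP : IsSmoothProjective dP P) (hdP : dP + 2 = dV) (c : ℕ)
    (hZ : IsSmoothProjective dV Z) (b : Z ⟶ M) (f : Z ⟶ V)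
    (hbalg : ∀ x ∈ algebraicClasses M c,
      complexGysin μ hZ hV f (show 2 * c + 2 * dV = 2 * c + 2 * dV from rfl)
        (complexBetti.map b (2 * c) x) ∈ algebraicClasses V c)
    {T : Type} [Fintype T] {E : T → Motives.SchemeOver ℂ}
    (hE : ∀ t, IsSmoothProjective (dP + 1) (E t)) (π : ∀ t, E t ⟶ P) [∀ t, Flat (π t).left]
    (g : ∀ t, E t ⟶ V) {T' : Type} [Fintype T'] (s : T' → (P ⟶ V))
    (hsurj : ∀ z : complexBetti V (2 * c),
      z ∈ LinearMap.range (complexGysin μ hZ hV f (show 2 * c + 2 * dV = 2 * c + 2 * dV from rfl) ∘ₗ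
          (complexBetti.map b (2 * c)).hom) ⊔
        (⨆ (c₀ : ℕ) (h : c₀ + 1 = c) (t : T), LinearMap.range
          (complexGysin μ (hE t) hV (g t) (show 2 * c₀ + 2 * dV = 2 * c + 2 * (dP + 1) by omega) ∘ₗ
            (complexBetti.map (π t) (2 * c₀)).hom)) ⊔
        ⨆ (c₀ : ℕ) (h : c₀ + 2 = c) (t : T'), LinearMap.range
          (complexGysin μ hP hV (s t) (show 2 * c₀ + 2 * dV = 2 * c + 2 * dP by omega))) :
    ∃ (Ψ : complexBetti (M) (2 * c) →ₗ[ℂ] complexBetti (V) (2 * c))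
      (T₁ : Type) (_ : Fintype T₁) (T₂ : Type) (_ : Fintype T₂)
      (Θ₁ : ∀ c₀ : ℕ, c₀ + 1 = c → T₁ → (complexBetti (P) (2 * c₀) →ₗ[ℂ] complexBetti (V) (2 * c)))
      (Θ₂ : ∀ c₀ : ℕ, c₀ + 2 = c → T₂ → (complexBetti (P) (2 * c₀) →ₗ[ℂ] complexBetti (V) (2 * c))),
      (∀ x ∈ algebraicClasses (M) c, Ψ x ∈ algebraicClasses (V) c) ∧
      (∀ x, IsRationalClass x → IsRationalClass (Ψ x)) ∧
      (∀ ⦃a b : ℕ⦄ ⦃x⦄, a + b = 2 * c → IsOfHodgeType (dV) (M) (2 * c) a b x →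
          IsOfHodgeType (dV) (V) (2 * c) a b (Ψ x)) ∧
      (∀ c₀ (h : c₀ + 1 = c) (t : T₁),
        (∀ y ∈ algebraicClasses (P) c₀, Θ₁ c₀ h t y ∈ algebraicClasses (V) c) ∧
        (∀ y, IsRationalClass y → IsRationalClass (Θ₁ c₀ h t y)) ∧
        (∀ ⦃a b : ℕ⦄ ⦃y⦄, a + b = 2 * c₀ → IsOfHodgeType (dP) (P) (2 * c₀) a b y →
            IsOfHodgeType (dV) (V) (2 * c) (a + 1) (b + 1) (Θ₁ c₀ h t y))) ∧
      (∀ c₀ (h : c₀ + 2 = c) (t : T₂),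
        (∀ y ∈ algebraicClasses (P) c₀, Θ₂ c₀ h t y ∈ algebraicClasses (V) c) ∧
        (∀ y, IsRationalClass y → IsRationalClass (Θ₂ c₀ h t y)) ∧
        (∀ ⦃a b : ℕ⦄ ⦃y⦄, a + b = 2 * c₀ → IsOfHodgeType (dP) (P) (2 * c₀) a b y →
            IsOfHodgeType (dV) (V) (2 * c) (a + 2) (b + 2) (Θ₂ c₀ h t y))) ∧
      ∀ z : complexBetti (V) (2 * c),
        z ∈ LinearMap.range Ψ ⊔ (⨆ (c₀ : ℕ) (h : c₀ + 1 = c) (t : T₁), LinearMap.range (Θ₁ c₀ h t)) ⊔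
          ⨆ (c₀ : ℕ) (h : c₀ + 2 = c) (t : T₂), LinearMap.range (Θ₂ c₀ h t) := by
  have hμ := OrientationFamily.hasPoincareDuality μ
  -- the main span: `u • f_* b^*` is a rational Hodge-linear map of bidegree `(0, 0)`
  obtain ⟨u, hu, hrat, htyp⟩ := isRationalHodgeMap_complexGysin_comp_map μ hμ hZ hM hV b f
    (show 2 * c + 2 * dV = 2 * c + 2 * dV from rfl) (Nat.add_zero c)
  -- the exceptional spans: `uₜ • gₜ_* πₜ^*`, bidegree `(1, 1)`
  have key₁ : ∀ (c₀ : ℕ) (h : c₀ + 1 = c) (t : T), ∃ u' : ℂ, u' ≠ 0 ∧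
      (∀ y : complexBetti P (2 * c₀), IsRationalClass y →
        IsRationalClass (u' • complexGysin μ (hE t) hV (g t)
          (show 2 * c₀ + 2 * dV = 2 * c + 2 * (dP + 1) by omega) (complexBetti.map (π t) (2 * c₀) y))) ∧
      ∀ ⦃a b' : ℕ⦄ ⦃y : complexBetti P (2 * c₀)⦄, a + b' = 2 * c₀ → IsOfHodgeType dP P (2 * c₀) a b' y →
        IsOfHodgeType dV V (2 * c) (a + 1) (b' + 1)
          (complexGysin μ (hE t) hV (g t) (show 2 * c₀ + 2 * dV = 2 * c + 2 * (dP + 1) by omega)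
            (complexBetti.map (π t) (2 * c₀) y)) :=
    fun c₀ h t ↦ isRationalHodgeMap_complexGysin_comp_map μ hμ (hE t) hP hV (π t) (g t) _ h
  choose u₁ hu₁ hrat₁ htyp₁ using key₁
  -- the sections: `uₜ' • sₜ,*`, bidegree `(2, 2)` (the span `P ←𝟙— P —sₜ→ V`)
  have e0 : ∀ (c₀ : ℕ) (y : complexBetti P (2 * c₀)), complexBetti.map (𝟙 P) (2 * c₀) y = y :=
    fun c₀ y ↦ by rw [complexBetti.map_id]; rfl
  have key₂ : ∀ (c₀ : ℕ) (h : c₀ + 2 = c) (t : T'), ∃ u' : ℂ, u' ≠ 0 ∧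
      (∀ y : complexBetti P (2 * c₀), IsRationalClass y →
        IsRationalClass (u' • complexGysin μ hP hV (s t)
          (show 2 * c₀ + 2 * dV = 2 * c + 2 * dP by omega) y)) ∧
      ∀ ⦃a b' : ℕ⦄ ⦃y : complexBetti P (2 * c₀)⦄, a + b' = 2 * c₀ → IsOfHodgeType dP P (2 * c₀) a b' y →
        IsOfHodgeType dV V (2 * c) (a + 2) (b' + 2)
          (complexGysin μ hP hV (s t) (show 2 * c₀ + 2 * dV = 2 * c + 2 * dP by omega) y) := by
    intro c₀ h t
    obtain ⟨u', hu', hr, ht⟩ := isRationalHodgeMap_complexGysin_comp_map μ hμ hP hP hV (𝟙 P) (s t)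
      (show 2 * c₀ + 2 * dV = 2 * c + 2 * dP by omega) h
    refine ⟨u', hu', fun y hy ↦ ?_, fun a b' y hab hy ↦ ?_⟩
    · simpa only [e0] using hr y hy
    · simpa only [e0] using ht hab hy
  choose u₂ hu₂ hrat₂ htyp₂ using key₂
  refine ⟨u • (complexGysin μ hZ hV f (show 2 * c + 2 * dV = 2 * c + 2 * dV from rfl) ∘ₗ
      (complexBetti.map b (2 * c)).hom), T, inferInstance, T', inferInstance,
    fun c₀ h t ↦ u₁ c₀ h t • (complexGysin μ (hE t) hV (g t)
      (show 2 * c₀ + 2 * dV = 2 * c + 2 * (dP + 1) by omega) ∘ₗ (complexBetti.map (π t) (2 * c₀)).hom),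
    fun c₀ h t ↦ u₂ c₀ h t • complexGysin μ hP hV (s t)
      (show 2 * c₀ + 2 * dV = 2 * c + 2 * dP by omega),
    fun x hx ↦ ?_, fun x hx ↦ ?_, fun a b' x hab hx ↦ ?_, fun c₀ h t ↦ ⟨fun y hy ↦ ?_, fun y hy ↦ ?_,
      fun a b' y hab hy ↦ ?_⟩, fun c₀ h t ↦ ⟨fun y hy ↦ ?_, fun y hy ↦ ?_, fun a b' y hab hy ↦ ?_⟩,
      fun z ↦ ?_⟩
  · rw [LinearMap.smul_apply]
    exact Submodule.smul_mem _ _ (hbalg x hx)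
  · rw [LinearMap.smul_apply]
    exact hrat x hx
  · rw [LinearMap.smul_apply]
    exact (htyp hab hx).smul u
  · rw [LinearMap.smul_apply]
    exact Submodule.smul_mem _ _ (complexGysin_map_mem_algebraicClasses_of_flat μ (hE t) hP hV
      (π t) (g t) (by omega) hy)
  · rw [LinearMap.smul_apply]
    exact hrat₁ c₀ h t y hy
  · rw [LinearMap.smul_apply]
    exact (htyp₁ c₀ h t hab hy).smul _
  · rw [LinearMap.smul_apply]
    exact Submodule.smul_mem _ _ (complexGysin_mem_algebraicClasses
      (gysinMap_restrictCompl_eq_zero_of_field ℂ) μ hμ hP hV (s t) (by omega) _ hy)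
  · rw [LinearMap.smul_apply]
    exact hrat₂ c₀ h t y hy
  · rw [LinearMap.smul_apply]
    exact (htyp₂ c₀ h t hab hy).smul _
  · have e1 : LinearMap.range (u • (complexGysin μ hZ hV f
        (show 2 * c + 2 * dV = 2 * c + 2 * dV from rfl) ∘ₗ (complexBetti.map b (2 * c)).hom)) =
        LinearMap.range (complexGysin μ hZ hV f (show 2 * c + 2 * dV = 2 * c + 2 * dV from rfl) ∘ₗ
          (complexBetti.map b (2 * c)).hom) := LinearMap.range_smul _ _ hu
    have e2 : ∀ (c₀ : ℕ) (h : c₀ + 1 = c) (t : T),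
        LinearMap.range (u₁ c₀ h t • (complexGysin μ (hE t) hV (g t)
          (show 2 * c₀ + 2 * dV = 2 * c + 2 * (dP + 1) by omega) ∘ₗ
            (complexBetti.map (π t) (2 * c₀)).hom)) =
        LinearMap.range (complexGysin μ (hE t) hV (g t)
          (show 2 * c₀ + 2 * dV = 2 * c + 2 * (dP + 1) by omega) ∘ₗ
            (complexBetti.map (π t) (2 * c₀)).hom) :=
      fun c₀ h t ↦ LinearMap.range_smul _ _ (hu₁ c₀ h t)
    have e3 : ∀ (c₀ : ℕ) (h : c₀ + 2 = c) (t : T'),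
        LinearMap.range (u₂ c₀ h t • complexGysin μ hP hV (s t)
          (show 2 * c₀ + 2 * dV = 2 * c + 2 * dP by omega)) =
        LinearMap.range (complexGysin μ hP hV (s t) (show 2 * c₀ + 2 * dV = 2 * c + 2 * dP by omega)) :=
      fun c₀ h t ↦ LinearMap.range_smul _ _ (hu₂ c₀ h t)
    rw [e1]
    simp_rw [e2, e3]
    exact hsurj z

/-- **Joint surjectivity from the spanning on `Z` and the surjectivity of `f_*`.** In the diagram
`M ←b— Z —f→ V` with exceptional `jₜ : Eₜ ⟶ Z`, `πₜ : Eₜ ⟶ P` and sections `σₜ : P ⟶ Eₜ`: if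
`H²ᶜ(Z) = b^*H²ᶜ(M) + Σₜ jₜ,* πₜ^* H^{2c-2}(P) + Σₜ (jₜ,* ∘ σₜ,*) H^{2c-4}(P)` (the blow-up formula,
Lemma 2.1, with the cohomology of the exceptional projective bundles written through their sections,
Voisin I Lemma 7.32) and `f_*` is onto, then
`H²ᶜ(V) = f_*b^*H²ᶜ(M) + Σₜ (jₜ ≫ f)_* πₜ^* H^{2c-2}(P) + Σₜ (σₜ ≫ jₜ ≫ f)_* H^{2c-4}(P)` — the
hypothesis `hsurj` of `inductiveStepClause₂_of_spans` with `gₜ = jₜ ≫ f`, `sₜ = σₜ ≫ jₜ ≫ f` —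
by the functoriality of the Gysin morphisms (`complexGysin_comp`).
[cite: ShiodaKatsura1979, §2 Lemma 2.1, (2.3)–(2.9), (2.17)] [cite: VoisinHodgeI2002, Thm. 7.31 and Lemma 7.32] -/
theorem blowupDiagram₂_joint_surjective (μ : OrientationFamily) {V P Z M : Motives.SchemeOver ℂ}
    {dV dP : ℕ} (hV : IsSmoothProjective dV V) (hP : IsSmoothProjective dP P) (hdP : dP + 2 = dV)
    (c : ℕ) (hZ : IsSmoothProjective dV Z) (b : Z ⟶ M) (f : Z ⟶ V)
    {T : Type} {E : T → Motives.SchemeOver ℂ} (hE : ∀ t, IsSmoothProjective (dP + 1) (E t))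
    (π : ∀ t, E t ⟶ P) (σ : ∀ t, P ⟶ E t) (j : ∀ t, E t ⟶ Z)
    (hZspan : ∀ z : complexBetti Z (2 * c),
      z ∈ LinearMap.range (complexBetti.map b (2 * c)).hom ⊔
        (⨆ (c₀ : ℕ) (h : c₀ + 1 = c) (t : T), LinearMap.range
          (complexGysin μ (hE t) hZ (j t) (show 2 * c₀ + 2 * dV = 2 * c + 2 * (dP + 1) by omega) ∘ₗ
            (complexBetti.map (π t) (2 * c₀)).hom)) ⊔
        ⨆ (c₀ : ℕ) (h : c₀ + 2 = c) (t : T), LinearMap.range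
          (complexGysin μ (hE t) hZ (j t)
              (show (2 * c₀ + 2) + 2 * dV = 2 * c + 2 * (dP + 1) by omega) ∘ₗ
            complexGysin μ hP (hE t) (σ t)
              (show 2 * c₀ + 2 * (dP + 1) = (2 * c₀ + 2) + 2 * dP by omega)))
    (hf : Function.Surjective
      (complexGysin μ hZ hV f (show 2 * c + 2 * dV = 2 * c + 2 * dV from rfl))) :
    ∀ z : complexBetti V (2 * c),
      z ∈ LinearMap.range (complexGysin μ hZ hV f (show 2 * c + 2 * dV = 2 * c + 2 * dV from rfl) ∘ₗ
          (complexBetti.map b (2 * c)).hom) ⊔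
        (⨆ (c₀ : ℕ) (h : c₀ + 1 = c) (t : T), LinearMap.range
          (complexGysin μ (hE t) hV (j t ≫ f)
              (show 2 * c₀ + 2 * dV = 2 * c + 2 * (dP + 1) by omega) ∘ₗ
            (complexBetti.map (π t) (2 * c₀)).hom)) ⊔
        ⨆ (c₀ : ℕ) (h : c₀ + 2 = c) (t : T), LinearMap.range
          (complexGysin μ hP hV (σ t ≫ j t ≫ f) (show 2 * c₀ + 2 * dV = 2 * c + 2 * dP by omega)) := by
  have hμ := OrientationFamily.hasPoincareDuality μ
  intro z
  obtain ⟨z', rfl⟩ := hf z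
  -- `(jₜ ≫ f)_* ∘ πₜ^* = f_* ∘ (jₜ,* ∘ πₜ^*)`
  have hcomp : ∀ (c₀ : ℕ) (hdeg : 2 * c₀ + 2 * dV = 2 * c + 2 * (dP + 1)) (t : T),
      complexGysin μ (hE t) hV (j t ≫ f) hdeg ∘ₗ (complexBetti.map (π t) (2 * c₀)).hom =
        complexGysin μ hZ hV f (show 2 * c + 2 * dV = 2 * c + 2 * dV from rfl) ∘ₗ
          (complexGysin μ (hE t) hZ (j t) hdeg ∘ₗ (complexBetti.map (π t) (2 * c₀)).hom) :=
    fun c₀ hdeg t ↦ by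
    rw [complexGysin_comp hμ (hE t) hZ hV (j t) f hdeg (show 2 * c + 2 * dV = 2 * c + 2 * dV from rfl)]
    exact LinearMap.comp_assoc _ _ _
  -- `(σₜ ≫ jₜ ≫ f)_* = f_* ∘ (jₜ,* ∘ σₜ,*)`
  have hcomp₂ : ∀ (c₀ : ℕ) (h : c₀ + 2 = c) (t : T),
      complexGysin μ hP hV (σ t ≫ j t ≫ f) (show 2 * c₀ + 2 * dV = 2 * c + 2 * dP by omega) =
        complexGysin μ hZ hV f (show 2 * c + 2 * dV = 2 * c + 2 * dV from rfl) ∘ₗ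
          (complexGysin μ (hE t) hZ (j t)
              (show (2 * c₀ + 2) + 2 * dV = 2 * c + 2 * (dP + 1) by omega) ∘ₗ
            complexGysin μ hP (hE t) (σ t)
              (show 2 * c₀ + 2 * (dP + 1) = (2 * c₀ + 2) + 2 * dP by omega)) := by
    intro c₀ h t
    rw [complexGysin_comp hμ hP (hE t) hV (σ t) (j t ≫ f)
        (show 2 * c₀ + 2 * (dP + 1) = (2 * c₀ + 2) + 2 * dP by omega)
        (show (2 * c₀ + 2) + 2 * dV = 2 * c + 2 * (dP + 1) by omega),
      complexGysin_comp hμ (hE t) hZ hV (j t) f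
        (show (2 * c₀ + 2) + 2 * dV = 2 * c + 2 * (dP + 1) by omega)
        (show 2 * c + 2 * dV = 2 * c + 2 * dV from rfl)]
    exact LinearMap.comp_assoc _ _ _
  simp_rw [hcomp]
  have e3 : (⨆ (c₀ : ℕ) (h : c₀ + 2 = c) (t : T), LinearMap.range
      (complexGysin μ hP hV (σ t ≫ j t ≫ f) (show 2 * c₀ + 2 * dV = 2 * c + 2 * dP by omega))) =
      ⨆ (c₀ : ℕ) (h : c₀ + 2 = c) (t : T), LinearMap.range
        (complexGysin μ hZ hV f (show 2 * c + 2 * dV = 2 * c + 2 * dV from rfl) ∘ₗ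
          (complexGysin μ (hE t) hZ (j t)
              (show (2 * c₀ + 2) + 2 * dV = 2 * c + 2 * (dP + 1) by omega) ∘ₗ
            complexGysin μ hP (hE t) (σ t)
              (show 2 * c₀ + 2 * (dP + 1) = (2 * c₀ + 2) + 2 * dP by omega))) := by
    refine iSup_congr fun c₀ ↦ iSup_congr fun h ↦ iSup_congr fun t ↦ ?_
    rw [hcomp₂ c₀ h t]
  rw [e3]
  simp_rw [LinearMap.range_comp _
    (complexGysin μ hZ hV f (show 2 * c + 2 * dV = 2 * c + 2 * dV from rfl)),
    ← Submodule.map_iSup, ← Submodule.map_sup]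
  exact Submodule.mem_map_of_mem (hZspan z')

/-- **One clause of the step from the blow-up diagram (1.25) `× W`, through coniveau.** Granted
Deligne's Cor. 8.2.8 (`hD`), the clause at `(V, M, P, c)` follows from: a smooth projective `Z` of
dimension `dim V` with `b : Z ⟶ M` dropping codimension by at most one (the blow-up `β × id`: a local
isomorphism off the exceptional divisor, `ℙ¹`-fibres over the centre) and a SURJECTIVE `f : Z ⟶ V`
(`ψ × id`, onto by Lemma 1.3 (ii) and properness; then `f_*` is onto,
`complexGysin_surjective_of_surjective`); finitely many smooth projective `Eₜ` of dimension
`dim P + 1` with FLAT `πₜ : Eₜ ⟶ P`, morphisms `σₜ : P ⟶ Eₜ` and `jₜ : Eₜ ⟶ Z` (the exceptional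
`ℙ¹`-bundles over the centre components, their sections and inclusions); and the spanning
`H²ᶜ(Z) = b^*H²ᶜ(M) + Σₜ jₜ,*πₜ^*H^{2c-2}(P) + Σₜ jₜ,*σₜ,*H^{2c-4}(P)` (Lemma 2.1 for a centre of
codimension `2` with Voisin I Lemma 7.32 for the exceptional bundles). The pull-back along `b` carries
algebraic classes to algebraic classes by `map_mem_algebraicClasses_of_coheight_le_add_one`.
[cite: ShiodaKatsura1979, §1 (1.4)–(1.6), Lemma 1.3 (ii), Thm. 1.7 (1.25), Remark 1.9; §2 Lemma 2.1, Cor. 2.5 (2.9), (2.17)–(2.19)]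
[cite: Voisin2013GHCBloch, Lemma 2.1 (proof)] [cite: VoisinHodgeI2002, Thm. 7.31, Lemma 7.32, §7.3.2 Lemma 7.28] -/
theorem inductiveStepClause₂_of_blowupDiagram_of_surjective
    (hD : Deligne1974_ker_restrictCompl_eq_iSup_range_complexGysin) (μ : OrientationFamily)
    {V M P Z : Motives.SchemeOver ℂ}
    {dV dP : ℕ} (hV : IsSmoothProjective dV V) (hM : IsSmoothProjective dV M)
    (hP : IsSmoothProjective dP P) (hdP : dP + 2 = dV) (c : ℕ)
    (hZ : IsSmoothProjective dV Z) (b : Z ⟶ M)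
    (hb : ∀ z : Z.left, Order.coheight (b.left.base z) ≤ Order.coheight z + 1)
    (f : Z ⟶ V) [Surjective f.left]
    {T : Type} [Fintype T] {E : T → Motives.SchemeOver ℂ}
    (hE : ∀ t, IsSmoothProjective (dP + 1) (E t)) (π : ∀ t, E t ⟶ P) [∀ t, Flat (π t).left]
    (σ : ∀ t, P ⟶ E t) (j : ∀ t, E t ⟶ Z)
    (hZspan : ∀ z : complexBetti Z (2 * c),
      z ∈ LinearMap.range (complexBetti.map b (2 * c)).hom ⊔
        (⨆ (c₀ : ℕ) (h : c₀ + 1 = c) (t : T), LinearMap.range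
          (complexGysin μ (hE t) hZ (j t) (show 2 * c₀ + 2 * dV = 2 * c + 2 * (dP + 1) by omega) ∘ₗ
            (complexBetti.map (π t) (2 * c₀)).hom)) ⊔
        ⨆ (c₀ : ℕ) (h : c₀ + 2 = c) (t : T), LinearMap.range
          (complexGysin μ (hE t) hZ (j t)
              (show (2 * c₀ + 2) + 2 * dV = 2 * c + 2 * (dP + 1) by omega) ∘ₗ
            complexGysin μ hP (hE t) (σ t)
              (show 2 * c₀ + 2 * (dP + 1) = (2 * c₀ + 2) + 2 * dP by omega))) :
    ∃ (Ψ : complexBetti (M) (2 * c) →ₗ[ℂ] complexBetti (V) (2 * c))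
      (T₁ : Type) (_ : Fintype T₁) (T₂ : Type) (_ : Fintype T₂)
      (Θ₁ : ∀ c₀ : ℕ, c₀ + 1 = c → T₁ → (complexBetti (P) (2 * c₀) →ₗ[ℂ] complexBetti (V) (2 * c)))
      (Θ₂ : ∀ c₀ : ℕ, c₀ + 2 = c → T₂ → (complexBetti (P) (2 * c₀) →ₗ[ℂ] complexBetti (V) (2 * c))),
      (∀ x ∈ algebraicClasses (M) c, Ψ x ∈ algebraicClasses (V) c) ∧
      (∀ x, IsRationalClass x → IsRationalClass (Ψ x)) ∧
      (∀ ⦃a b : ℕ⦄ ⦃x⦄, a + b = 2 * c → IsOfHodgeType (dV) (M) (2 * c) a b x →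
          IsOfHodgeType (dV) (V) (2 * c) a b (Ψ x)) ∧
      (∀ c₀ (h : c₀ + 1 = c) (t : T₁),
        (∀ y ∈ algebraicClasses (P) c₀, Θ₁ c₀ h t y ∈ algebraicClasses (V) c) ∧
        (∀ y, IsRationalClass y → IsRationalClass (Θ₁ c₀ h t y)) ∧
        (∀ ⦃a b : ℕ⦄ ⦃y⦄, a + b = 2 * c₀ → IsOfHodgeType (dP) (P) (2 * c₀) a b y →
            IsOfHodgeType (dV) (V) (2 * c) (a + 1) (b + 1) (Θ₁ c₀ h t y))) ∧
      (∀ c₀ (h : c₀ + 2 = c) (t : T₂),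
        (∀ y ∈ algebraicClasses (P) c₀, Θ₂ c₀ h t y ∈ algebraicClasses (V) c) ∧
        (∀ y, IsRationalClass y → IsRationalClass (Θ₂ c₀ h t y)) ∧
        (∀ ⦃a b : ℕ⦄ ⦃y⦄, a + b = 2 * c₀ → IsOfHodgeType (dP) (P) (2 * c₀) a b y →
            IsOfHodgeType (dV) (V) (2 * c) (a + 2) (b + 2) (Θ₂ c₀ h t y))) ∧
      ∀ z : complexBetti (V) (2 * c),
        z ∈ LinearMap.range Ψ ⊔ (⨆ (c₀ : ℕ) (h : c₀ + 1 = c) (t : T₁), LinearMap.range (Θ₁ c₀ h t)) ⊔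
          ⨆ (c₀ : ℕ) (h : c₀ + 2 = c) (t : T₂), LinearMap.range (Θ₂ c₀ h t) :=
  inductiveStepClause₂_of_spans μ hV hM hP hdP c hZ b f
    (fun _ hx ↦ complexGysin_map_mem_algebraicClasses_of_coheight_le_add_one hD μ hZ hM hV b hb f rfl hx)
    hE π (fun t ↦ j t ≫ f) (fun t ↦ σ t ≫ j t ≫ f)
    (blowupDiagram₂_joint_surjective μ hV hP hdP c hZ b f hE π σ j hZspan
      (complexGysin_surjective_of_surjective μ hZ hV f rfl))

end Spans

/-! ### The named fact from Deligne's Cor. 8.2.8 and the GEOMETRY of Thm. 1.7 -/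

section Assembly

/-- **`FermatHodgeClassesLiftToCurvePowersSum` from Deligne's Cor. 8.2.8 and the blow-up diagrams of
Shioda–Katsura's Thm. 1.7 with the spanning form of the blow-up formula.** The residual input in
purely geometric form. `hA'` (first step, Remark 1.9 `× W`: `X²ₘ` from `X¹ₘ × X¹ₘ`, centre
`X⁰ₘ × X⁰ₘ × W`) and `hB'` (Thm. 1.7 at `(r + 1, 1)` `× W`, `r ≥ 1`: `X^{r+2}ₘ` from `X^{r+1}ₘ × X¹ₘ`,
centre components `Xʳₘ × W`) ask, for every `m ≥ 1`, every smooth projective auxiliary factor `W`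
and every half-degree `c`, for: a smooth projective `Z` of the dimension of the target (in print the
blow-up (1.4) `× W`) with a morphism `b` to the main host DROPPING CODIMENSION BY AT MOST ONE
(`codim b(z) ≤ codim z + 1`: `β × id` is a local isomorphism off the exceptional divisor and has
`ℙ¹`-fibres over the centre, (1.5)–(1.6)) and a SURJECTIVE morphism `f` to the target (`ψ × id`,
Lemma 1.3 (ii)); finitely many smooth projective `Eₜ` of dimension `dim P + 1` with FLAT
`πₜ : Eₜ ⟶ P`, morphisms `σₜ : P ⟶ Eₜ` and `jₜ : Eₜ ⟶ Z` (the exceptional `ℙ¹`-bundles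
`ℙ(O(1) ⊕ O)` over the centre components with a section and their inclusions); and the spanning
`H²ᶜ(Z) = b^*H²ᶜ(M) + Σₜ jₜ,*πₜ^*H^{2c-2}(P) + Σₜ jₜ,*σₜ,*H^{2c-4}(P)` (Lemma 2.1 for the codimension-2
centre, the cohomology of the exceptional bundles being `π^*H(P) ⊕ σ_*H(P)`, Voisin I Lemma 7.32), for
some orientation family `μ`. Granted these and Deligne's Cor. 8.2.8 (`hD`, through which the pull-back
along the non-flat `b` keeps algebraic classes: Voisin 2013, proof of Lemma 2.1), each clause of the
one-step statement holds (`inductiveStepClause₂_of_blowupDiagram_of_surjective`) and the induction on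
`r` gives the named fact (`FermatHodgeClassesLiftToCurvePowersSum_of_inductiveStep₂`).
[cite: ShiodaKatsura1979, §1 (1.4)–(1.6), Lemma 1.2, Lemma 1.3 (ii), Thm. 1.7 (1.25), Remark 1.9; §2 Lemma 2.1, Prop. 2.4 (2.5), Cor. 2.5 (2.9), (2.17)–(2.19), Thm. 2.10; §3 p. 107–108]
[cite: DeligneHodgeIII1974, Cor. 8.2.8] [cite: Voisin2013GHCBloch, Lemma 2.1 (proof)]
[cite: VoisinHodgeI2002, Thm. 7.31, Lemma 7.32 and §7.3.2] [cite: Voisin2025, Cor. 2.12] -/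
theorem FermatHodgeClassesLiftToCurvePowersSum_of_blowupGeometry
    (hD : Deligne1974_ker_restrictCompl_eq_iSup_range_complexGysin)
    (hA' : ∀ (m : ℕ) (hm : 1 ≤ m) (w : ℕ) (W : Motives.SchemeOver ℂ) (hW : IsSmoothProjective w W)
      (c : ℕ),
      ∃ (μ : OrientationFamily) (Z : Motives.SchemeOver ℂ) (hZ : IsSmoothProjective (2 + w) Z)
        (b : Z ⟶ (fermatHypersurface 1 m ⊗ fermatHypersurface 1 m) ⊗ W)
        (_ : ∀ z : Z.left, Order.coheight (b.left.base z) ≤ Order.coheight z + 1)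
        (f : Z ⟶ fermatHypersurface 2 m ⊗ W) (_ : Surjective f.left)
        (T : Type) (_ : Fintype T) (E : T → Motives.SchemeOver ℂ)
        (hE : ∀ t, IsSmoothProjective (w + 1) (E t)) (π : ∀ t, E t ⟶ W)
        (_ : ∀ t, Flat (π t).left) (σ : ∀ t, W ⟶ E t) (j : ∀ t, E t ⟶ Z),
        ∀ z : complexBetti Z (2 * c),
          z ∈ LinearMap.range (complexBetti.map b (2 * c)).hom ⊔
            (⨆ (c₀ : ℕ) (h : c₀ + 1 = c) (t : T), LinearMap.range
              (complexGysin μ (hE t) hZ (j t)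
                  (show 2 * c₀ + 2 * (2 + w) = 2 * c + 2 * (w + 1) by omega) ∘ₗ
                (complexBetti.map (π t) (2 * c₀)).hom)) ⊔
            ⨆ (c₀ : ℕ) (h : c₀ + 2 = c) (t : T), LinearMap.range
              (complexGysin μ (hE t) hZ (j t)
                  (show (2 * c₀ + 2) + 2 * (2 + w) = 2 * c + 2 * (w + 1) by omega) ∘ₗ
                complexGysin μ hW (hE t) (σ t)
                  (show 2 * c₀ + 2 * (w + 1) = (2 * c₀ + 2) + 2 * w by omega)))
    (hB' : ∀ (m r : ℕ) (hm : 1 ≤ m) (hr : 1 ≤ r) (w : ℕ) (W : Motives.SchemeOver ℂ)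
      (hW : IsSmoothProjective w W) (c : ℕ),
      ∃ (μ : OrientationFamily) (Z : Motives.SchemeOver ℂ) (hZ : IsSmoothProjective (r + 2 + w) Z)
        (b : Z ⟶ (fermatHypersurface (r + 1) m ⊗ fermatHypersurface 1 m) ⊗ W)
        (_ : ∀ z : Z.left, Order.coheight (b.left.base z) ≤ Order.coheight z + 1)
        (f : Z ⟶ fermatHypersurface (r + 2) m ⊗ W) (_ : Surjective f.left)
        (T : Type) (_ : Fintype T) (E : T → Motives.SchemeOver ℂ)
        (hE : ∀ t, IsSmoothProjective (r + w + 1) (E t)) (π : ∀ t, E t ⟶ fermatHypersurface r m ⊗ W)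
        (_ : ∀ t, Flat (π t).left) (σ : ∀ t, fermatHypersurface r m ⊗ W ⟶ E t) (j : ∀ t, E t ⟶ Z),
        ∀ z : complexBetti Z (2 * c),
          z ∈ LinearMap.range (complexBetti.map b (2 * c)).hom ⊔
            (⨆ (c₀ : ℕ) (h : c₀ + 1 = c) (t : T), LinearMap.range
              (complexGysin μ (hE t) hZ (j t)
                  (show 2 * c₀ + 2 * (r + 2 + w) = 2 * c + 2 * (r + w + 1) by omega) ∘ₗ
                (complexBetti.map (π t) (2 * c₀)).hom)) ⊔
            ⨆ (c₀ : ℕ) (h : c₀ + 2 = c) (t : T), LinearMap.range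
              (complexGysin μ (hE t) hZ (j t)
                  (show (2 * c₀ + 2) + 2 * (r + 2 + w) = 2 * c + 2 * (r + w + 1) by omega) ∘ₗ
                complexGysin μ (IsSmoothProjective.tensor_holds (isSmoothProjective_fermatHypersurface hr hm) hW) (hE t) (σ t)
                  (show 2 * c₀ + 2 * (r + w + 1) = (2 * c₀ + 2) + 2 * (r + w) by omega))) :
    FermatHodgeClassesLiftToCurvePowersSum := by
  refine FermatHodgeClassesLiftToCurvePowersSum_of_inductiveStep₂ (fun m hm w W hW c ↦ ?_)
    (fun m r hm hr w W hW c ↦ ?_)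
  · obtain ⟨μ, Z, hZ, b, hb, f, hf, T, hT, E, hE, π, hπ, σ, j, hZspan⟩ := hA' m hm w W hW c
    haveI := hf
    haveI := hT
    haveI := hπ
    have h1 : IsSmoothProjective 1 (fermatHypersurface 1 m) :=
      isSmoothProjective_fermatHypersurface le_rfl hm
    have h2 : IsSmoothProjective 2 (fermatHypersurface 2 m) :=
      isSmoothProjective_fermatHypersurface (by norm_num) hm
    have hV : IsSmoothProjective (2 + w) (fermatHypersurface 2 m ⊗ W) :=
      IsSmoothProjective.tensor_holds h2 hW
    have hM : IsSmoothProjective (2 + w) ((fermatHypersurface 1 m ⊗ fermatHypersurface 1 m) ⊗ W) :=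
      IsSmoothProjective.tensor_holds (IsSmoothProjective.tensor_holds h1 h1) hW
    exact inductiveStepClause₂_of_blowupDiagram_of_surjective hD μ hV hM hW (by omega) c hZ b hb f
      hE π σ j hZspan
  · obtain ⟨μ, Z, hZ, b, hb, f, hf, T, hT, E, hE, π, hπ, σ, j, hZspan⟩ := hB' m r hm hr w W hW c
    haveI := hf
    haveI := hT
    haveI := hπ
    have h1 : IsSmoothProjective 1 (fermatHypersurface 1 m) :=
      isSmoothProjective_fermatHypersurface le_rfl hm
    have hr1 : IsSmoothProjective (r + 1) (fermatHypersurface (r + 1) m) :=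
      isSmoothProjective_fermatHypersurface (by omega) hm
    have hr2 : IsSmoothProjective (r + 2) (fermatHypersurface (r + 2) m) :=
      isSmoothProjective_fermatHypersurface (by omega) hm
    have hV : IsSmoothProjective (r + 2 + w) (fermatHypersurface (r + 2) m ⊗ W) :=
      IsSmoothProjective.tensor_holds hr2 hW
    have hM₁ : IsSmoothProjective (r + 1 + 1)
        (fermatHypersurface (r + 1) m ⊗ fermatHypersurface 1 m) :=
      IsSmoothProjective.tensor_holds hr1 h1
    have hM : IsSmoothProjective (r + 2 + w)
        ((fermatHypersurface (r + 1) m ⊗ fermatHypersurface 1 m) ⊗ W) :=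
      IsSmoothProjective.tensor_holds (n := r + 2) hM₁ hW
    exact inductiveStepClause₂_of_blowupDiagram_of_surjective hD μ hV hM
      (IsSmoothProjective.tensor_holds (isSmoothProjective_fermatHypersurface hr hm) hW) (by omega) c
      hZ b hb f hE π σ j hZspan

end Assembly

/-! ### Codimension drops by at most one along the blow-up: from the blow-up square -/

section Coheight

/-- **Codimension drops by at most one along the blow-up, from the blow-up square.** Let
`b : Z ⟶ M` be a morphism of smooth projective varieties of the same dimension `dV` which is an
isomorphism over the open `U ⊆ M`, and suppose the complement of `b⁻¹U` is covered by closed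
immersions `jₜ : Eₜ ⟶ Z` of smooth projective `Eₜ` of dimension `dP + 1`, each sitting in a
commutative square `jₜ ≫ b = πₜ ≫ iₜ` with `πₜ : Eₜ ⟶ P` FLAT onto a smooth projective `P` of
dimension `dP`, `dP + 2 = dV`, and `iₜ : P ⟶ M` a closed immersion (the blow-up of `M` along the
smooth centre `⊔ₜ iₜ(P)` of codimension `2`, with its exceptional `ℙ¹`-bundles). Then
`codim b(z) ≤ codim z + 1` at every point: over `U` codimension is preserved (open immersions and
isomorphisms preserve it); at `z = jₜ(e)`, `codim_M iₜ(πₜ e) = codim_P πₜ(e) + 2 ≤ codim_{Eₜ} e + 2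
= codim_Z jₜ(e) + 1` (dimension formula `dim + codim = dim X` on `M`, `P`, `Z`, `Eₜ`; closed immersions
preserve `dim cl{·}`; codimension does not drop along the flat `πₜ`, Hartshorne III 9.5). This is the
hypothesis of `map_mem_algebraicClasses_of_coheight_le_add_one`. [cite: Hartshorne1977, III Prop. 9.5 and II Ex. 3.20]
[cite: StacksProject, Tag 0A21] [cite: ShiodaKatsura1979, §1 (1.4)–(1.6)] -/
theorem coheight_le_coheight_add_one_of_blowupSquare {Z M P : Motives.SchemeOver ℂ} {dV dP : ℕ}
    (hZ : IsSmoothProjective dV Z) (hM : IsSmoothProjective dV M) (hP : IsSmoothProjective dP P)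
    (hdP : dP + 2 = dV) (b : Z ⟶ M) (U : M.left.Opens) [IsIso (b.left ∣_ U)]
    {T : Type} {E : T → Motives.SchemeOver ℂ} (hE : ∀ t, IsSmoothProjective (dP + 1) (E t))
    (π : ∀ t, E t ⟶ P) [∀ t, Flat (π t).left] (j : ∀ t, E t ⟶ Z) [∀ t, IsClosedImmersion (j t).left]
    (i : T → (P ⟶ M)) [∀ t, IsClosedImmersion (i t).left] (hsq : ∀ t, j t ≫ b = π t ≫ i t)
    (hcov : ((b.left ⁻¹ᵁ U : Set Z.left))ᶜ ⊆ ⋃ t, Set.range (j t).left.base) (z : Z.left) :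
    Order.coheight (b.left.base z) ≤ Order.coheight z + 1 := by
  by_cases hz : z ∈ b.left ⁻¹ᵁ U
  · -- over `U`, `b` is an isomorphism: codimension is preserved
    have hz' : z ∈ Set.range (b.left ⁻¹ᵁ U).ι.base := by
      rw [Scheme.Opens.range_ι]
      exact hz
    obtain ⟨z', rfl⟩ := hz'
    have e2 : b.left.base ((b.left ⁻¹ᵁ U).ι.base z') = U.ι.base ((b.left ∣_ U).base z') := by
      have h := congrArg (fun φ ↦ φ.base z') (morphismRestrict_ι b.left U)
      exact h.symm
    have e3 := coheight_base_eq_of_iso (asIso (b.left ∣_ U)) z'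
    rw [asIso_hom] at e3
    rw [e2, coheight_eq_of_isOpenImmersion U.ι, e3, coheight_eq_of_isOpenImmersion (b.left ⁻¹ᵁ U).ι]
    exact le_self_add
  · -- on the exceptional locus
    obtain ⟨t, e, rfl⟩ : ∃ t e, (j t).left.base e = z := by
      have h := hcov hz
      simpa only [Set.mem_iUnion, Set.mem_range] using h
    haveI : IsLocallyNoetherian (E t).left := IsSmoothProjective.isLocallyNoetherian_holds (hE t)
    haveI : IsLocallyNoetherian P.left := IsSmoothProjective.isLocallyNoetherian_holds hP
    have hb : b.left.base ((j t).left.base e) = (i t).left.base ((π t).left.base e) := by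
      have h1 : b.left.base ((j t).left.base e) = (j t ≫ b).left.base e := rfl
      rw [h1, hsq t]
      rfl
    rw [hb]
    obtain ⟨a1, c1, ha1, hc1, h1⟩ :=
      exists_height_eq_coheight_eq hM ((i t).left.base ((π t).left.base e))
    obtain ⟨a2, c2, ha2, hc2, h2⟩ := exists_height_eq_coheight_eq hP ((π t).left.base e)
    obtain ⟨a3, c3, ha3, hc3, h3⟩ := exists_height_eq_coheight_eq hZ ((j t).left.base e)
    obtain ⟨a4, c4, ha4, hc4, h4⟩ := exists_height_eq_coheight_eq (hE t) e
    have e12 : a1 = a2 := by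
      have h := Motives.Scheme.height_base_eq_of_isClosedImmersion (i t).left ((π t).left.base e)
      rw [ha1, ha2] at h
      exact_mod_cast h
    have e34 : a3 = a4 := by
      have h := Motives.Scheme.height_base_eq_of_isClosedImmersion (j t).left e
      rw [ha3, ha4] at h
      exact_mod_cast h
    have hflat : (c2 : ℕ∞) ≤ c4 := by
      rw [← hc2, ← hc4]
      exact coheight_base_le_of_flat (π t).left e
    have hflat' : c2 ≤ c4 := by exact_mod_cast hflat
    rw [hc1, hc3]
    have h : c1 ≤ c3 + 1 := by omega
    exact_mod_cast h

end Coheight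

/-! ### The spanning on `Z` from the geometry: proper modification + exceptional projective bundles
with a section -/

section SpanningFromGeometry

/-- **The spanning `H²ᶜ(Z) = b^*H²ᶜ(M) + Σₜ jₜ,*πₜ^*H^{2c-2}(P) + Σₜ jₜ,*σₜ,*H^{2c-4}(P)` from the
geometry of the blow-up** (Voisin I, Thm. 7.31 with Lemma 7.32; Shioda–Katsura Lemma 2.1, spanning
half). Data: `b : Z ⟶ M` birational between smooth projective varieties of the same dimension `dV`,
an isomorphism over the open `U ⊆ M`; closed immersions `jₜ : Eₜ ⟶ Z` of smooth projective `Eₜ` of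
dimension `dP + 1` (`dP + 2 = dV`) with pairwise disjoint images covering `Z ∖ b⁻¹U` (the
components of the exceptional divisor); morphisms `πₜ : Eₜ ⟶ P` and closed immersions
`σₜ : P ⟶ Eₜ` such that every class of `Hᵃ(Eₜ(ℂ); ℂ)` agrees with a pulled-back class `πₜ^* p`
off `σₜ(P)` (for the `ℙ¹`-bundle `ℙ(O(1) ⊕ O) → P` with its two disjoint sections: the complement
of one section is a line bundle over `P`, retracting onto the other — Lemma 7.32). Then the two
proved topological layers (`mem_range_map_sup_iSup_range_complexGysin_of_isIso_restrict`: every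
class on `Z` is `b^* y` plus Gysin images from the `Eₜ`; Thom–Gysin for the closed immersion `σₜ`,
`ker_restrictCompl_eq_iSup_range_complexGysin_of_isClosedImmersion`: a class on `Eₜ` dying off
`σₜ(P)` is `σₜ,* y'`) give the spanning in every even degree, in the shape of the hypothesis
`hZspan` of `inductiveStepClause₂_of_blowupDiagram_of_surjective`.
[cite: VoisinHodgeI2002, Thm. 7.31 and Lemma 7.32] [cite: ShiodaKatsura1979, §2 Lemma 2.1]
[cite: DeligneHodgeIII1974, Cor. 8.2.8] -/
theorem blowupGeometry_span₂ (μ : OrientationFamily) {M P Z : Motives.SchemeOver ℂ} {dV dP : ℕ}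
    (hM : IsSmoothProjective dV M) (hP : IsSmoothProjective dP P) (hdP : dP + 2 = dV) (c : ℕ)
    (hZ : IsSmoothProjective dV Z) (b : Z ⟶ M) (hbir : Resolution.IsBirational b.left)
    (U : M.left.Opens) [IsIso (b.left ∣_ U)]
    {T : Type} [Fintype T] {E : T → Motives.SchemeOver ℂ}
    (hE : ∀ t, IsSmoothProjective (dP + 1) (E t)) (π : ∀ t, E t ⟶ P)
    (σ : ∀ t, P ⟶ E t) [∀ t, IsClosedImmersion (σ t).left]
    (j : ∀ t, E t ⟶ Z) [∀ t, IsClosedImmersion (j t).left]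
    (hdisj : Pairwise (Function.onFun Disjoint fun t ↦ Set.range (j t).left.base))
    (hcov : ((b.left ⁻¹ᵁ U : Set Z.left))ᶜ = ⋃ t, Set.range (j t).left.base)
    (hEspan : ∀ (t : T) (a : ℕ) (e : complexBetti (E t) a), ∃ p : complexBetti P a,
      complexBetti.restrictCompl (E t) (Set.range (σ t).left.base) a
        (e - complexBetti.map (π t) a p) = 0) :
    ∀ z : complexBetti Z (2 * c),
      z ∈ LinearMap.range (complexBetti.map b (2 * c)).hom ⊔
        (⨆ (c₀ : ℕ) (h : c₀ + 1 = c) (t : T), LinearMap.range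
          (complexGysin μ (hE t) hZ (j t) (show 2 * c₀ + 2 * dV = 2 * c + 2 * (dP + 1) by omega) ∘ₗ
            (complexBetti.map (π t) (2 * c₀)).hom)) ⊔
        ⨆ (c₀ : ℕ) (h : c₀ + 2 = c) (t : T), LinearMap.range
          (complexGysin μ (hE t) hZ (j t)
              (show (2 * c₀ + 2) + 2 * dV = 2 * c + 2 * (dP + 1) by omega) ∘ₗ
            complexGysin μ hP (hE t) (σ t)
              (show 2 * c₀ + 2 * (dP + 1) = (2 * c₀ + 2) + 2 * dP by omega)) := by
  intro z
  have hz := mem_range_map_sup_iSup_range_complexGysin_of_isIso_restrict μ hZ hM b hbir U hE j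
    hdisj hcov (2 * c) z
  -- the Gysin images from the `Eₜ` decompose along `πₜ^*` and `σₜ,*`
  rw [sup_assoc]
  refine (SetLike.le_def.1 (sup_le_sup_left ?_ _)) hz
  refine iSup_le fun t ↦ iSup_le fun a ↦ iSup_le fun hab ↦ ?_
  -- `a = 2c - 2`: write `c = c₀ + 1`, `a = 2 c₀`
  obtain ⟨c₀, rfl⟩ : ∃ c₀, c = c₀ + 1 := ⟨c - 1, by omega⟩
  obtain rfl : a = 2 * c₀ := by omega
  rintro _ ⟨e, rfl⟩
  obtain ⟨p, hp⟩ := hEspan t (2 * c₀) e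
  have hker : e - complexBetti.map (π t) (2 * c₀) p ∈
      LinearMap.ker (complexBetti.restrictCompl (E t) (Set.range (σ t).left.base) (2 * c₀)).hom := hp
  rw [ker_restrictCompl_eq_iSup_range_complexGysin_of_isClosedImmersion μ (hE t) hP (σ t) (2 * c₀)]
    at hker
  have he : e = complexBetti.map (π t) (2 * c₀) p + (e - complexBetti.map (π t) (2 * c₀) p) := by abel
  rw [he, map_add]
  refine Submodule.add_mem_sup ?_ ?_
  · -- the `πₜ^*` part
    exact Submodule.mem_iSup_of_mem c₀ (Submodule.mem_iSup_of_mem rfl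
      (Submodule.mem_iSup_of_mem t ⟨p, rfl⟩))
  · -- the `σₜ,*` part
    generalize e - complexBetti.map (π t) (2 * c₀) p = w at hker ⊢
    induction hker using Submodule.iSup_induction' with
    | mem a' x hx =>
      induction hx using Submodule.iSup_induction' with
      | mem hab' x hx =>
        obtain ⟨y', rfl⟩ := hx
        -- `a' = 2c₀ - 2`: write `c₀ = c₁ + 1`, `a' = 2 c₁`
        obtain ⟨c₁, rfl⟩ : ∃ c₁, c₀ = c₁ + 1 := ⟨c₀ - 1, by omega⟩
        obtain rfl : a' = 2 * c₁ := by omega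
        refine Submodule.mem_iSup_of_mem c₁ (Submodule.mem_iSup_of_mem rfl
          (Submodule.mem_iSup_of_mem t ⟨y', ?_⟩))
        rfl
      | zero => rw [map_zero]; exact Submodule.zero_mem _
      | add x x' _ _ hx hx' => rw [map_add]; exact Submodule.add_mem _ hx hx'
    | zero => rw [map_zero]; exact Submodule.zero_mem _
    | add x x' _ _ hx hx' => rw [map_add]; exact Submodule.add_mem _ hx hx'

/-- **`FermatHodgeClassesLiftToCurvePowersSum` from Deligne's Cor. 8.2.8 and the GEOMETRY of
Shioda–Katsura's Thm. 1.7** — the blow-up formula no longer an input. For each step (`hA'`: Remark 1.9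
`× W`; `hB'`: Thm. 1.7 at `(r + 1, 1)` `× W`, `r ≥ 1`) the hypotheses ask for the diagram (1.25) `× W`
as smooth projective `ℂ`-schemes and morphisms with their printed geometric properties, and nothing
cohomological except the `𝔸¹`-bundle statement on the exceptional components:
a smooth projective `Z` of the dimension of the target with `b : Z ⟶ M` BIRATIONAL, an ISOMORPHISM
over an open `U ⊆ M` ((1.4)–(1.5): the blow-up `β × id` is an isomorphism off the centre);
`f : Z ⟶ V` SURJECTIVE (`ψ × id`, Lemma 1.3 (ii)); finitely many smooth projective `Eₜ` of dimension
`dim P + 1` with FLAT `πₜ : Eₜ ⟶ P`, closed immersions `σₜ : P ⟶ Eₜ`, `jₜ : Eₜ ⟶ Z` and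
`iₜ : P ⟶ M` with `jₜ ≫ b = πₜ ≫ iₜ` (the blow-up squares of the components `ℙ(O(1) ⊕ O) → Xʳₘ × W`
of the exceptional divisor over the components of the centre, (1.6), whence `b` drops codimension by
at most one, `coheight_le_coheight_add_one_of_blowupSquare`), the `jₜ(Eₜ)` pairwise disjoint and
covering `Z ∖ b⁻¹U`; and, on each `Eₜ`, every class of
`Hᵃ(Eₜ(ℂ); ℂ)` agrees off `σₜ(P)` with a class pulled back from `P` (the complement of the section
is a line bundle over `P`; Voisin I, Lemma 7.32). Granted these and `hD` (Deligne's Cor. 8.2.8, through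
which `b^*` keeps algebraic classes: Voisin 2013, proof of Lemma 2.1), the spanning on `Z` is
`blowupGeometry_span₂` (the blow-up formula, Lemma 2.1, PROVED in this form from the tree's topology),
each clause of the step is `inductiveStepClause₂_of_blowupDiagram_of_surjective`, and the induction on
`r` gives the named fact.
[cite: ShiodaKatsura1979, §1 (1.4)–(1.6), Lemma 1.2, Lemma 1.3 (ii), Thm. 1.7 (1.25), Remark 1.9; §2 Lemma 2.1, Prop. 2.4 (2.5), Cor. 2.5 (2.9), (2.17)–(2.19), Thm. 2.10; §3 p. 107–108]
[cite: DeligneHodgeIII1974, Cor. 8.2.8] [cite: Voisin2013GHCBloch, Lemma 2.1 (proof)]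
[cite: VoisinHodgeI2002, Thm. 7.31, Lemma 7.32, Lemma 7.28 and §7.3.2] [cite: Voisin2025, Cor. 2.12] -/
theorem FermatHodgeClassesLiftToCurvePowersSum_of_blowupGeometry₃
    (hD : Deligne1974_ker_restrictCompl_eq_iSup_range_complexGysin)
    (hA' : ∀ (m : ℕ) (hm : 1 ≤ m) (w : ℕ) (W : Motives.SchemeOver ℂ) (hW : IsSmoothProjective w W)
      (c : ℕ),
      ∃ (Z : Motives.SchemeOver ℂ) (_ : IsSmoothProjective (2 + w) Z)
        (b : Z ⟶ (fermatHypersurface 1 m ⊗ fermatHypersurface 1 m) ⊗ W) (_ : Resolution.IsBirational b.left)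
        (U : ((fermatHypersurface 1 m ⊗ fermatHypersurface 1 m) ⊗ W).left.Opens) (_ : IsIso (b.left ∣_ U))
        (f : Z ⟶ fermatHypersurface 2 m ⊗ W) (_ : Surjective f.left)
        (T : Type) (_ : Fintype T) (E : T → Motives.SchemeOver ℂ)
        (_ : ∀ t, IsSmoothProjective (w + 1) (E t)) (π : ∀ t, E t ⟶ W)
        (_ : ∀ t, Flat (π t).left) (σ : ∀ t, W ⟶ E t) (_ : ∀ t, IsClosedImmersion (σ t).left)
        (j : ∀ t, E t ⟶ Z) (_ : ∀ t, IsClosedImmersion (j t).left)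
        (i : T → (W ⟶ (fermatHypersurface 1 m ⊗ fermatHypersurface 1 m) ⊗ W))
        (_ : ∀ t, IsClosedImmersion (i t).left) (_ : ∀ t, j t ≫ b = π t ≫ i t)
        (_ : Pairwise (Function.onFun Disjoint fun t ↦ Set.range (j t).left.base))
        (_ : ((b.left ⁻¹ᵁ U : Set Z.left))ᶜ = ⋃ t, Set.range (j t).left.base),
        ∀ (t : T) (a : ℕ) (e : complexBetti (E t) a), ∃ p : complexBetti (W) a,
          complexBetti.restrictCompl (E t) (Set.range (σ t).left.base) a
            (e - complexBetti.map (π t) a p) = 0)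
    (hB' : ∀ (m r : ℕ) (hm : 1 ≤ m) (hr : 1 ≤ r) (w : ℕ) (W : Motives.SchemeOver ℂ)
      (hW : IsSmoothProjective w W) (c : ℕ),
      ∃ (Z : Motives.SchemeOver ℂ) (_ : IsSmoothProjective (r + 2 + w) Z)
        (b : Z ⟶ (fermatHypersurface (r + 1) m ⊗ fermatHypersurface 1 m) ⊗ W) (_ : Resolution.IsBirational b.left)
        (U : ((fermatHypersurface (r + 1) m ⊗ fermatHypersurface 1 m) ⊗ W).left.Opens) (_ : IsIso (b.left ∣_ U))
        (f : Z ⟶ fermatHypersurface (r + 2) m ⊗ W) (_ : Surjective f.left)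
        (T : Type) (_ : Fintype T) (E : T → Motives.SchemeOver ℂ)
        (_ : ∀ t, IsSmoothProjective (r + w + 1) (E t)) (π : ∀ t, E t ⟶ fermatHypersurface r m ⊗ W)
        (_ : ∀ t, Flat (π t).left) (σ : ∀ t, fermatHypersurface r m ⊗ W ⟶ E t) (_ : ∀ t, IsClosedImmersion (σ t).left)
        (j : ∀ t, E t ⟶ Z) (_ : ∀ t, IsClosedImmersion (j t).left)
        (i : T → (fermatHypersurface r m ⊗ W ⟶ (fermatHypersurface (r + 1) m ⊗ fermatHypersurface 1 m) ⊗ W))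
        (_ : ∀ t, IsClosedImmersion (i t).left) (_ : ∀ t, j t ≫ b = π t ≫ i t)
        (_ : Pairwise (Function.onFun Disjoint fun t ↦ Set.range (j t).left.base))
        (_ : ((b.left ⁻¹ᵁ U : Set Z.left))ᶜ = ⋃ t, Set.range (j t).left.base),
        ∀ (t : T) (a : ℕ) (e : complexBetti (E t) a), ∃ p : complexBetti (fermatHypersurface r m ⊗ W) a,
          complexBetti.restrictCompl (E t) (Set.range (σ t).left.base) a
            (e - complexBetti.map (π t) a p) = 0) :
    FermatHodgeClassesLiftToCurvePowersSum := by
  -- an orientation family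
  let μ : OrientationFamily := fun _ _ h ↦ Classical.choice (Motives.ComplexPoints.isOrientableOver ℂ h)
  refine FermatHodgeClassesLiftToCurvePowersSum_of_inductiveStep₂ (fun m hm w W hW c ↦ ?_)
    (fun m r hm hr w W hW c ↦ ?_)
  · obtain ⟨Z, hZ, b, hbir, U, hU, f, hf, T, hT, E, hE, π, hπ, σ, hσ, j, hj, i, hi, hsq, hdisj, hcov, hEspan⟩ :=
      hA' m hm w W hW c
    haveI := hU
    haveI := hf
    haveI := hT
    haveI := hπ
    haveI := hσ
    haveI := hj
    haveI := hi
    have h1 : IsSmoothProjective 1 (fermatHypersurface 1 m) :=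
      isSmoothProjective_fermatHypersurface le_rfl hm
    have h2 : IsSmoothProjective 2 (fermatHypersurface 2 m) :=
      isSmoothProjective_fermatHypersurface (by norm_num) hm
    have hV : IsSmoothProjective (2 + w) (fermatHypersurface 2 m ⊗ W) :=
      IsSmoothProjective.tensor_holds h2 hW
    have hM : IsSmoothProjective (2 + w) ((fermatHypersurface 1 m ⊗ fermatHypersurface 1 m) ⊗ W) :=
      IsSmoothProjective.tensor_holds (IsSmoothProjective.tensor_holds h1 h1) hW
    exact inductiveStepClause₂_of_blowupDiagram_of_surjective hD μ hV hM hW (by omega) c hZ b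
      (coheight_le_coheight_add_one_of_blowupSquare hZ hM hW (by omega) b U hE π j i hsq hcov.le) f
      hE π σ j (blowupGeometry_span₂ μ hM hW (by omega) c hZ b hbir U hE π σ j hdisj hcov hEspan)
  · obtain ⟨Z, hZ, b, hbir, U, hU, f, hf, T, hT, E, hE, π, hπ, σ, hσ, j, hj, i, hi, hsq, hdisj, hcov, hEspan⟩ :=
      hB' m r hm hr w W hW c
    haveI := hU
    haveI := hf
    haveI := hT
    haveI := hπ
    haveI := hσ
    haveI := hj
    haveI := hi
    have h1 : IsSmoothProjective 1 (fermatHypersurface 1 m) :=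
      isSmoothProjective_fermatHypersurface le_rfl hm
    have hr1 : IsSmoothProjective (r + 1) (fermatHypersurface (r + 1) m) :=
      isSmoothProjective_fermatHypersurface (by omega) hm
    have hr2 : IsSmoothProjective (r + 2) (fermatHypersurface (r + 2) m) :=
      isSmoothProjective_fermatHypersurface (by omega) hm
    have hV : IsSmoothProjective (r + 2 + w) (fermatHypersurface (r + 2) m ⊗ W) :=
      IsSmoothProjective.tensor_holds hr2 hW
    have hM₁ : IsSmoothProjective (r + 1 + 1)
        (fermatHypersurface (r + 1) m ⊗ fermatHypersurface 1 m) :=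
      IsSmoothProjective.tensor_holds hr1 h1
    have hM : IsSmoothProjective (r + 2 + w)
        ((fermatHypersurface (r + 1) m ⊗ fermatHypersurface 1 m) ⊗ W) :=
      IsSmoothProjective.tensor_holds (n := r + 2) hM₁ hW
    have hP : IsSmoothProjective (r + w) (fermatHypersurface r m ⊗ W) :=
      IsSmoothProjective.tensor_holds (isSmoothProjective_fermatHypersurface hr hm) hW
    exact inductiveStepClause₂_of_blowupDiagram_of_surjective hD μ hV hM hP (by omega) c hZ b
      (coheight_le_coheight_add_one_of_blowupSquare hZ hM hP (by omega) b U hE π j i hsq hcov.le) f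
      hE π σ j (blowupGeometry_span₂ μ hM hP (by omega) c hZ b hbir U hE π σ j hdisj hcov hEspan)

end SpanningFromGeometry

end Literature.AlgebraicGeometry.HodgeTheory
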